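import Literature.Analysis.FluidPDE.Tao2016AveragedNS.RetunedTransition
import Literature.Analysis.FluidPDE.Tao2016AveragedNS.TriggerTolerance

/-!
# Trigger tolerance for the retuned family (Theorem 5.3 of Tao 2016 from a kicked datum, uniformly in `M`)

Framing (page 1, mandatory): low prior, high value-of-information experiment on Tao's machine
paradigm; NOT a claim that NS blows up.

`RetunedTransition.lean` proves Theorem 5.3 of [Tao2016AveragedNS] for the one-parameter family
`delayCircuitWith K M ε` (seed `ε²e^{-M}`, amplifier `ε⁻¹M`, `3000 log K ≤ M ≤ K¹⁰`) from the
designed datum `delayInit = (1,0,0,0,0)`; `TriggerTolerance.lean` proves it for Tao's circuit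
(`M = K¹⁰`) from the KICKED datum `kickInit κ = (√(1-κ²), 0, κ, 0, 0)` as long as the pre-load of
the trigger mode is below `kickTolerance K ε = ε²e^{-K¹⁰ + K⁹√K/4}` — doubly-exponentially small
in the machine's size parameter, which is the "single-trajectory theorem" caveat made quantitative.

This file does both at once: **Theorem 5.3 for every member of the family from the kicked datum**,
with the tolerance

  `kickToleranceWith K M ε = ε² e^{-M} K¹⁰ = seed × K¹⁰`

(`kickTransitionWith_explicit`: same constants as `transitionWith_explicit` except the critical
window `24 log K / M ↦ 44 log K / M`). The point is the member `M = p log K`: there the tolerance is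
`ε² K^{10-p}` — a POWER of `K` (`kickToleranceWith_log`, `polySeedKickTolerance`), against
`ε² e^{-K¹⁰(1 - o(1))}` for Tao's `M = K¹⁰`. So the retuned gate is not only triggered by a
polynomially small seed, it also tolerates a polynomially small error in its trigger channel: the
fragility of the delay gate in the trigger direction is an artefact of the choice `M = K¹⁰`, not of
the mechanism (cf. `TriggerFragility.lean`, `DIVERGENCE.md` D10/D19).

## The proof

Tao's bootstrap, ported once more (`Thm53With` → `Thm53KickWith`, exactly as `Thm53` → `Thm53Kick`):
the datum enters only through `b(0) = d(0) = ã(0) = 0`, `c(0) = κ ≥ 0`, `|a(0) - 1| ≤ κ ≤ ε²/2` and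
energy one. The tolerance `κe^{M} ≤ K¹⁰ε²` is spent in exactly two places: the early side of the
critical window (the super-solution now starts from `κ`, `c(t) ≤ (κe^{M} + 2ε²)e^{Mt²/2+1-M} ≤
3K¹⁰ε² e^{Mt²/2+1-M}`, whence `2 - 44 log K/M ≤ t_c²` instead of `2 - 24 log K/M`) and the bound
`∂ₜb ≥ -ε/16` after `t_c` (where `c ≤ 3K¹⁰ε²e^{9M}` costs a `K²⁰` inside the threshold
`ε² ≤ e^{-18M}/(144 M K²⁰)`, still implied by `ε ≤ e^{-10M}/K¹⁰⁰`). Everything from the critical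
time on is verbatim. The kick must also lie below the trigger level `K⁻¹⁰ε²` of the bootstrap
(`IsKickedWith.lt_level`, needs `21 log K ≤ M`) so that the hitting-time device starts.

Main statements: `kickToleranceWith`, `Thm53KickWith.IsKickedWith` (+ `of_le_tolerance`),
`kickTransitionWith_explicit` (Theorem 5.3, kicked, explicit constants, all `M`),
`polySeedKickTolerance` (`M = p log K`: tolerance `ε²K¹⁰/Kᵖ`, window `44/p`, onset `880/p`),
`kickToleranceWith_self_le` (at `M = K¹⁰` our tolerance is below Tao's `kickTolerance`: this file
does not use the `√2 - 1/√K` early margin, so it is cruder there, by design — uniformity in `M` is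
the point).

Reused by name: `Thm53` (integrating-factor toolkit, `exists_hitTime`, `invSqrt_facts`, `Es_alg`,
`decay_alg`, `numeric_N4`), `Thm53With` (`continuous_traj`, `hasDerivAt_a…d`, `hasDerivAt_V`,
`hasDerivAt_Es`, `log_facts`, `abs_sub_sqrt_two_le`, `window_fits`), `DelayWith.hasDerivAt_e`,
`kickInit`, `energy_kickInit`, `kick_init_b…e` (`TriggerFragility.lean`).

## References
* T. Tao, JAMS 29 (2016) 601–674, arXiv:1402.0290, §5.5 Theorem 5.3 and its proof. [`Tao2016AveragedNS`]
-/

noncomputable section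

namespace Literature.Analysis.FluidPDE.Tao2016AveragedNS

open Set Real Filter
open _root_.Topology

/-- The **trigger tolerance of the family**: `ε² e^{-M} K¹⁰ = seed × K¹⁰`. A pre-load of the
trigger mode `c` of this size does not disturb the conclusion of Theorem 5.3 for
`delayCircuitWith K M ε`. [cite: Tao2016AveragedNS, §5.5 proof of Theorem 5.3] -/
def kickToleranceWith (K M ε : ℝ) : ℝ := ε ^ 2 * exp (-M) * K ^ 10

/-- The tolerance is positive (`ε ≠ 0`, `K > 0`). [folklore] -/
theorem kickToleranceWith_pos {K M ε : ℝ} (hK : 0 < K) (hε : 0 < ε) :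
    0 < kickToleranceWith K M ε := by
  unfold kickToleranceWith; positivity

/-- **The tolerance is polynomial on the logarithmic members**: for `M = p log K`,
`kickToleranceWith K M ε = ε² K¹⁰ / Kᵖ`. [cite: Tao2016AveragedNS, §5.5 (5.5)] -/
theorem kickToleranceWith_log {K : ℝ} (hK : 0 < K) (p : ℕ) (ε : ℝ) :
    kickToleranceWith K (p * Real.log K) ε = ε ^ 2 * K ^ 10 / K ^ p := by
  unfold kickToleranceWith
  rw [exp_neg_natMul_log hK p, div_eq_mul_inv]
  ring

/-- At Tao's member `M = K¹⁰` the tolerance of this file, `ε²K¹⁰e^{-K¹⁰}`, is below the sharper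
`kickTolerance K ε = ε²e^{-K¹⁰ + K⁹√K/4}` of `TriggerTolerance.lean` (`K ≥ 16`; `10 log K ≤ K⁹√K/4`):
uniformity in `M` is bought by not using the early margin `√2 - 1/√K`. [folklore] -/
theorem kickToleranceWith_self_le {K ε : ℝ} (hK : 16 ≤ K) :
    kickToleranceWith K (K ^ 10) ε ≤ kickTolerance K ε := by
  have hK0 : 0 < K := by linarith
  have hK1 : 1 ≤ K := by linarith
  unfold kickToleranceWith kickTolerance
  have hlogK : Real.log K ≤ K := (Real.log_le_sub_one_of_pos hK0).trans (by linarith)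
  have hs4 : 4 ≤ sqrt K := by
    rw [show (4 : ℝ) = sqrt 16 by rw [show (16 : ℝ) = 4 ^ 2 by norm_num, sqrt_sq (by norm_num)]]
    exact sqrt_le_sqrt hK
  have hK8 : (10 : ℝ) ≤ K ^ 8 := by
    have : (16 : ℝ) ^ 8 ≤ K ^ 8 := pow_le_pow_left₀ (by norm_num) hK 8
    linarith
  have h10 : 10 * Real.log K ≤ K ^ 9 * sqrt K / 4 := by
    calc 10 * Real.log K ≤ K ^ 8 * K := mul_le_mul hK8 hlogK (Real.log_nonneg hK1) (by positivity)
      _ = K ^ 9 * 4 / 4 := by ring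
      _ ≤ K ^ 9 * sqrt K / 4 := by
          apply div_le_div_of_nonneg_right _ (by norm_num)
          exact mul_le_mul_of_nonneg_left hs4 (by positivity)
  have hpow : K ^ 10 = exp ((10 : ℕ) * Real.log K) := by
    rw [Real.exp_nat_mul, Real.exp_log hK0]
  calc ε ^ 2 * exp (-K ^ 10) * K ^ 10 = ε ^ 2 * exp (-K ^ 10 + 10 * Real.log K) := by
        rw [hpow, mul_assoc, ← exp_add]; push_cast; ring_nf
    _ ≤ ε ^ 2 * exp (-K ^ 10 + K ^ 9 * sqrt K / 4) :=
        mul_le_mul_of_nonneg_left (exp_le_exp.2 (by linarith)) (sq_nonneg ε)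

namespace Thm53KickWith

open Thm53 (antitoneOn_intFactor monotoneOn_intFactor antitoneOn_sub_of_deriv_le
  monotoneOn_sub_of_le_deriv exists_hitTime abs_sub_le_of_abs_deriv_le sqrt_two_gt sqrt_two_lt
  invSqrt_facts Es_alg decay_alg numeric_N4)
open Thm53With (continuous_traj hasDerivAt_a hasDerivAt_b hasDerivAt_c hasDerivAt_d hasDerivAt_V
  hasDerivAt_Es log_facts abs_sub_sqrt_two_le window_fits)
open DelayWith (hasDerivAt_e)

/-! ## The kicked datum for the family: the bundle of hypotheses on the kick size -/

/-- The standing hypotheses on the kick, family version: the trajectory issues from `kickInit κ`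
with `0 ≤ κ ≤ min(1, ε²/2)` and `κe^{M} ≤ K¹⁰ε²` (i.e. `κ ≤ kickToleranceWith K M ε`).
[cite: Tao2016AveragedNS, §5.5 (5.6)] -/
structure IsKickedWith (K M ε κ : ℝ) (X : ℝ → Fin 5 → ℝ) : Prop where
  init : X 0 = kickInit κ
  nonneg : 0 ≤ κ
  le_one : κ ≤ 1
  le_half_sq : κ ≤ ε ^ 2 / 2
  le_tol : κ * exp M ≤ ε ^ 2 * K ^ 10

section KickBundle

variable {K M ε κ : ℝ} {X : ℝ → Fin 5 → ℝ}

/-- `Kⁿ ≤ e^{M}` once `n log K ≤ M` (`K > 0`). [folklore] -/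
theorem pow_le_exp_of_log_le (hK : 0 < K) (n : ℕ) (hM : n * Real.log K ≤ M) : K ^ n ≤ exp M := by
  have h := Real.exp_nat_mul (Real.log K) n
  rw [Real.exp_log hK] at h
  rw [← h]
  exact exp_le_exp.2 hM

/-- A kick below the tolerance satisfies the standing hypotheses (`K ≥ 2`, `11 log K ≤ M`,
`0 < ε ≤ 1`). [cite: Tao2016AveragedNS, §5.5 (5.6)] -/
theorem IsKickedWith.of_le_tolerance (hK : 2 ≤ K) (hM : 11 * Real.log K ≤ M) (hε : 0 < ε)
    (hε1 : ε ≤ 1) (hκ0 : 0 ≤ κ) (hκ : κ ≤ kickToleranceWith K M ε) (h0 : X 0 = kickInit κ) :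
    IsKickedWith K M ε κ X := by
  have hK0 : 0 < K := by linarith
  have hKM : K ^ 11 ≤ exp M := pow_le_exp_of_log_le hK0 11 (by push_cast; linarith)
  have hK10 : 2 * K ^ 10 ≤ K ^ 11 := by
    calc 2 * K ^ 10 ≤ K * K ^ 10 := mul_le_mul_of_nonneg_right hK (by positivity)
      _ = K ^ 11 := by ring
  unfold kickToleranceWith at hκ
  have hhalf : κ ≤ ε ^ 2 / 2 := by
    have h1 : exp (-M) * K ^ 10 ≤ 1 / 2 := by
      rw [exp_neg, inv_mul_le_iff₀ (exp_pos M)]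
      linarith
    calc κ ≤ ε ^ 2 * (exp (-M) * K ^ 10) := by rw [← mul_assoc]; exact hκ
      _ ≤ ε ^ 2 * (1 / 2) := mul_le_mul_of_nonneg_left h1 (sq_nonneg ε)
      _ = ε ^ 2 / 2 := by ring
  have hε2 : ε ^ 2 ≤ 1 := by nlinarith
  refine ⟨h0, hκ0, by linarith, hhalf, ?_⟩
  have hee : exp (-M) * exp M = 1 := by rw [← exp_add, neg_add_cancel, exp_zero]
  calc κ * exp M ≤ ε ^ 2 * exp (-M) * K ^ 10 * exp M :=
        mul_le_mul_of_nonneg_right hκ (exp_pos _).le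
    _ = ε ^ 2 * K ^ 10 := by linear_combination (ε ^ 2 * K ^ 10) * hee

/-- `κ² ≤ 1`. [folklore] -/
theorem IsKickedWith.sq_le_one (h0 : IsKickedWith K M ε κ X) : κ ^ 2 ≤ 1 :=
  pow_le_one₀ h0.nonneg h0.le_one

/-- The kick is below the trigger level of the bootstrap: `κ < K⁻¹⁰ε²` (`K > 1`, `21 log K ≤ M`,
`ε ≠ 0`), since `κ ≤ K¹⁰e^{-M}ε²` and `K²⁰ < K²¹ ≤ e^{M}`. [cite: Tao2016AveragedNS, §5.5 (boots)] -/
theorem IsKickedWith.lt_level (h0 : IsKickedWith K M ε κ X) (hK : 1 < K)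
    (hM : 21 * Real.log K ≤ M) (hε : 0 < ε) : κ < ε ^ 2 / K ^ 10 := by
  have hK0 : 0 < K := by linarith
  have hKM : K ^ 21 ≤ exp M := pow_le_exp_of_log_le hK0 21 (by push_cast; linarith)
  rw [lt_div_iff₀ (pow_pos hK0 10)]
  by_contra hge
  have hge' : ε ^ 2 ≤ κ * K ^ 10 := not_lt.1 hge
  have h1 : ε ^ 2 * K ^ 21 ≤ κ * K ^ 10 * exp M :=
    mul_le_mul hge' hKM (by positivity) (mul_nonneg h0.nonneg (by positivity))
  have h2 : κ * K ^ 10 * exp M ≤ ε ^ 2 * K ^ 20 := by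
    calc κ * K ^ 10 * exp M = K ^ 10 * (κ * exp M) := by ring
      _ ≤ K ^ 10 * (ε ^ 2 * K ^ 10) := mul_le_mul_of_nonneg_left h0.le_tol (by positivity)
      _ = ε ^ 2 * K ^ 20 := by ring
  have h4 : K ^ 21 ≤ K ^ 20 := le_of_mul_le_mul_left (by linarith) (pow_pos hε 2)
  have h5 : K ^ 20 < K ^ 21 := pow_lt_pow_right₀ hK (by norm_num)
  linarith

/-- `|a(0) - 1| ≤ κ` for the kicked datum (`1 - κ ≤ √(1-κ²) ≤ 1`). [cite: Tao2016AveragedNS, §5.5 (5.6)] -/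
theorem init_a_near (h0 : IsKickedWith K M ε κ X) : |X 0 0 - 1| ≤ κ := by
  have hκ0 := h0.nonneg
  have hκ1 := h0.le_one
  have ha : X 0 0 = sqrt (1 - κ ^ 2) := by simp [h0.init, kickInit]
  have hlow : 1 - κ ≤ sqrt (1 - κ ^ 2) := by
    calc 1 - κ = sqrt ((1 - κ) ^ 2) := (sqrt_sq (by linarith)).symm
      _ ≤ sqrt (1 - κ ^ 2) := sqrt_le_sqrt (by nlinarith)
  have hup : sqrt (1 - κ ^ 2) ≤ 1 := by
    simpa using sqrt_le_sqrt (show 1 - κ ^ 2 ≤ 1 by nlinarith)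
  rw [ha, abs_sub_comm, abs_of_nonneg (by linarith)]
  linarith

/-- (a-init), kicked: `b(0) = 0`. [cite: Tao2016AveragedNS, §5.5 (5.6)] -/
theorem init_b (h0 : IsKickedWith K M ε κ X) : X 0 1 = 0 := kick_init_b h0.init
/-- (a-init), kicked: `c(0) = κ`. [cite: Tao2016AveragedNS, §5.5 (5.6)] -/
theorem init_c (h0 : IsKickedWith K M ε κ X) : X 0 2 = κ := kick_init_c h0.init
/-- (a-init), kicked: `d(0) = 0`. [cite: Tao2016AveragedNS, §5.5 (5.6)] -/
theorem init_d (h0 : IsKickedWith K M ε κ X) : X 0 3 = 0 := kick_init_d h0.init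
/-- (a-init), kicked: `ã(0) = 0`. [cite: Tao2016AveragedNS, §5.5 (5.6)] -/
theorem init_e (h0 : IsKickedWith K M ε κ X) : X 0 4 = 0 := kick_init_e h0.init

/-- Energy conservation along the kicked trajectory of any member of the family.
[cite: Tao2016AveragedNS, §5.5 (energy-con)] -/
theorem kickWith_energy (hX : ∀ t, HasDerivAt X (delayCircuitWith K M ε (X t)) t)
    (h0 : IsKickedWith K M ε κ X) (t : ℝ) : energy (X t) = 1 := by
  rw [delayCircuitWith_energy hX t 0, h0.init, energy_kickInit h0.sq_le_one]

end KickBundle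

/-! ## The trajectory: energy, signs -/

section Trajectory

variable {K M ε κ : ℝ} {X : ℝ → Fin 5 → ℝ}

/-- (energy-con) in components. [cite: Tao2016AveragedNS, §5.5 (energy-con)] -/
theorem traj_sum_sq_eq_one (hX : ∀ t, HasDerivAt X (delayCircuitWith K M ε (X t)) t)
    (h0 : IsKickedWith K M ε κ X) (t : ℝ) :
    X t 0 ^ 2 + X t 1 ^ 2 + X t 2 ^ 2 + X t 3 ^ 2 + X t 4 ^ 2 = 1 := by
  have h := kickWith_energy hX h0 t
  simpa [energy, Fin.sum_univ_five] using h

/-- (est): every mode is `O(1)`. [cite: Tao2016AveragedNS, §5.5 (est)] -/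
theorem traj_sq_le_one (hX : ∀ t, HasDerivAt X (delayCircuitWith K M ε (X t)) t)
    (h0 : IsKickedWith K M ε κ X) (t : ℝ) (i : Fin 5) : X t i ^ 2 ≤ 1 := by
  have h := kickWith_energy hX h0 t
  rw [energy] at h
  calc X t i ^ 2 ≤ ∑ j, X t j ^ 2 :=
        Finset.single_le_sum (f := fun j => X t j ^ 2) (fun j _ => sq_nonneg (X t j))
          (Finset.mem_univ i)
    _ = 1 := h

/-- (est): `|Xᵢ| ≤ 1`. [cite: Tao2016AveragedNS, §5.5 (est)] -/
theorem traj_abs_le_one (hX : ∀ t, HasDerivAt X (delayCircuitWith K M ε (X t)) t)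
    (h0 : IsKickedWith K M ε κ X) (t : ℝ) (i : Fin 5) : |X t i| ≤ 1 :=
  sq_le_one_iff_abs_le_one _ |>.1 (traj_sq_le_one hX h0 t i)

/-- `ã ≥ 0` for `t ≥ 0` (it is non-decreasing from `0`). [cite: Tao2016AveragedNS, §5.5 proof] -/
theorem e_nonneg (hX : ∀ t, HasDerivAt X (delayCircuitWith K M ε (X t)) t) (h0 : IsKickedWith K M ε κ X)
    (hK : 0 ≤ K) {t : ℝ} (ht : 0 ≤ t) : 0 ≤ X t 4 := by
  have := delayCircuitWith_output_monotone hK hX ht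
  simpa [init_e h0] using this

/-! ## (ob-2): `b, c = O(ε)` on `[0,2]` -/

/-- (ob-2), quantitatively: `|b|, |c| ≤ 5ε` on `[0,2]`, from the local energy identity
`∂ₜ(b²+c²) = 2εa²b + 2μa²c` applied to `√(b²+c²+ε²)`. [cite: Tao2016AveragedNS, §5.5 (ob-2)] -/
theorem bc_small (hX : ∀ t, HasDerivAt X (delayCircuitWith K M ε (X t)) t) (h0 : IsKickedWith K M ε κ X)
    (hε : 0 < ε) (hε1 : ε ≤ 1) (hM0 : 0 ≤ M) {t : ℝ} (ht : t ∈ Icc 0 2) :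
    |X t 1| ≤ 5 * ε ∧ |X t 2| ≤ 5 * ε := by
  -- the kick is strictly below `ε`: `κ ≤ ε²/2 ≤ ε/2`
  have hκ0 : 0 ≤ κ := h0.nonneg
  have hκε : κ ^ 2 < ε ^ 2 := by
    have h1 : κ ≤ ε / 2 := h0.le_half_sq.trans (by nlinarith)
    nlinarith
  set f : ℝ → ℝ := fun s => X s 1 ^ 2 + X s 2 ^ 2 with hf
  set h : ℝ → ℝ := fun s => sqrt (f s + (ε ^ 2 - κ ^ 2)) with hh
  have hfpos : ∀ s, 0 < f s + (ε ^ 2 - κ ^ 2) := fun s => by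
    have : 0 ≤ f s := by positivity
    linarith
  have hb_le : ∀ s, |X s 1| ≤ h s := fun s =>
    abs_le_sqrt (by simp only [hf]; nlinarith [sq_nonneg (X s 2)])
  have hc_le : ∀ s, |X s 2| ≤ h s := fun s =>
    abs_le_sqrt (by simp only [hf]; nlinarith [sq_nonneg (X s 1)])
  have hder : ∀ s, HasDerivAt h
      ((2 * ε * X s 0 ^ 2 * X s 1 + 2 * ε ^ 2 * exp (-M) * X s 0 ^ 2 * X s 2)
        / (2 * sqrt (f s + (ε ^ 2 - κ ^ 2)))) s := fun s =>
    ((delayCircuitWith_bc_energy (hX s)).add_const (ε ^ 2 - κ ^ 2)).sqrt (hfpos s).ne'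
  have hbound : ∀ s, (2 * ε * X s 0 ^ 2 * X s 1 + 2 * ε ^ 2 * exp (-M) * X s 0 ^ 2 * X s 2)
        / (2 * sqrt (f s + (ε ^ 2 - κ ^ 2))) ≤ 2 * ε := by
    intro s
    have hhpos : 0 < sqrt (f s + (ε ^ 2 - κ ^ 2)) := sqrt_pos.2 (hfpos s)
    rw [div_le_iff₀ (by positivity)]
    have ha : X s 0 ^ 2 ≤ 1 := traj_sq_le_one hX h0 s 0
    have ha0 : 0 ≤ X s 0 ^ 2 := sq_nonneg _
    have hek : exp (-M) ≤ 1 := by rw [exp_le_one_iff, neg_nonpos]; exact hM0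
    have hbs : |X s 1| ≤ h s := hb_le s
    have hcs : |X s 2| ≤ h s := hc_le s
    have hb1 : X s 1 ≤ h s := (le_abs_self _).trans hbs
    have hc1 : X s 2 ≤ h s := (le_abs_self _).trans hcs
    have hc2 : -h s ≤ X s 2 := by have := neg_abs_le (X s 2); linarith
    have hh0 : 0 ≤ h s := (abs_nonneg _).trans hbs
    -- `a² b ≤ h`, `ε² e^{-k} a² c ≤ ε h`
    have h1 : X s 0 ^ 2 * X s 1 ≤ h s := by nlinarith
    have h21 : ε ^ 2 * exp (-M) ≤ ε := by
      calc ε ^ 2 * exp (-M) ≤ ε ^ 2 * 1 :=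
            mul_le_mul_of_nonneg_left hek (sq_nonneg _)
        _ = ε * ε := by ring
        _ ≤ ε * 1 := mul_le_mul_of_nonneg_left hε1 hε.le
        _ = ε := mul_one _
    have hεe : 0 ≤ ε ^ 2 * exp (-M) := by positivity
    have h22 : |X s 0 ^ 2 * X s 2| ≤ h s := by
      rw [abs_mul, abs_of_nonneg ha0]; nlinarith [abs_nonneg (X s 2)]
    have h23 : ε ^ 2 * exp (-M) * (X s 0 ^ 2 * X s 2) ≤ ε * h s := by
      calc ε ^ 2 * exp (-M) * (X s 0 ^ 2 * X s 2)
          ≤ ε ^ 2 * exp (-M) * |X s 0 ^ 2 * X s 2| :=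
            mul_le_mul_of_nonneg_left (le_abs_self _) hεe
        _ ≤ ε * h s := mul_le_mul h21 h22 (abs_nonneg _) hε.le
    have : h s = sqrt (f s + (ε ^ 2 - κ ^ 2)) := rfl
    rw [← this]
    nlinarith
  -- `h - 2εt` is antitone on `[0,2]`
  have hanti := antitoneOn_sub_of_deriv_le (convex_Icc 0 2) (fun s _ => hder s)
    (fun s _ => ((hasDerivAt_id s).const_mul (2 * ε))) (fun s _ => by simpa using hbound s)
  have h0mem : (0 : ℝ) ∈ Icc (0 : ℝ) 2 := ⟨le_rfl, by norm_num⟩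
  have hmono := hanti h0mem ht ht.1
  have hh0 : h 0 = ε := by
    have : f 0 + (ε ^ 2 - κ ^ 2) = ε ^ 2 := by simp only [hf, init_b h0, init_c h0]; ring
    simp only [hh, this, sqrt_sq hε.le]
  simp only [hh0, id, mul_zero, sub_zero] at hmono
  have hht : h t ≤ 5 * ε := by
    have := ht.2
    nlinarith
  exact ⟨(hb_le t).trans hht, (hc_le t).trans hht⟩

/-! ## `c ≥ 0` and the crude Grönwall bound (code) -/

/-- `c(t) ≥ 0` for `t ≥ 0` (from the initial condition `c(0) = κ ≥ 0` and a comparison argument),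
via the integrating factor `exp(-∫₀ᵗ ε⁻¹K¹⁰ b)`. [cite: Tao2016AveragedNS, §5.5 proof] -/
theorem c_nonneg (hX : ∀ t, HasDerivAt X (delayCircuitWith K M ε (X t)) t) (h0 : IsKickedWith K M ε κ X)
    {t : ℝ} (ht : 0 ≤ t) : 0 ≤ X t 2 := by
  set G : ℝ → ℝ := fun s => ∫ r in (0 : ℝ)..s, ε⁻¹ * M * X r 1 with hG
  have hGd : ∀ s, HasDerivAt G (ε⁻¹ * M * X s 1) s := fun s =>
    ((continuous_const.mul (continuous_traj hX 1)).integral_hasStrictDerivAt 0 s).hasDerivAt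
  have hmono := monotoneOn_intFactor (s := univ) (φ := fun _ => 0) (Φ := fun _ => 0) convex_univ
    (fun s _ => hasDerivAt_c hX s) (fun s _ => hGd s) (fun s _ => hasDerivAt_const s (0 : ℝ))
    (fun s _ => by
      have : (ε ^ 2 * exp (-M) * X s 0 ^ 2 + ε⁻¹ * M * X s 1 * X s 2
          - ε⁻¹ * M * X s 1 * X s 2) * exp (-G s)
          = ε ^ 2 * exp (-M) * X s 0 ^ 2 * exp (-G s) := by ring
      rw [this]; positivity)
  have h := hmono (mem_univ 0) (mem_univ t) ht
  have hG0 : G 0 = 0 := by simp [hG]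
  simp only [init_c h0, hG0, neg_zero, exp_zero, mul_one, sub_zero] at h
  exact (mul_nonneg_iff_of_pos_right (exp_pos (-G t))).1 (h0.nonneg.trans h)

/-- (code): the crude Grönwall bound `c(t) ≤ (κe^{M} + 2ε²) e^{(5t-1)M}` on `[0,2]` (from
`∂ₜc ≤ μ + 5K¹⁰ c`). [cite: Tao2016AveragedNS, §5.5 (code)] -/
theorem c_crude (hX : ∀ t, HasDerivAt X (delayCircuitWith K M ε (X t)) t) (h0 : IsKickedWith K M ε κ X)
    (hε : 0 < ε) (hε1 : ε ≤ 1) (hM0 : 0 ≤ M) {t : ℝ} (ht : t ∈ Icc 0 2) :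
    X t 2 ≤ (κ * exp M + 2 * ε ^ 2) * exp ((5 * t - 1) * M) := by
  set μ := ε ^ 2 * exp (-M) with hμ
  have hμ0 : 0 ≤ μ := by positivity
  have hanti := antitoneOn_intFactor (s := Icc 0 2) (g := fun _ => 5 * M)
    (G := fun s => 5 * M * s) (φ := fun _ => μ) (Φ := fun s => μ * s) (convex_Icc 0 2)
    (fun s _ => hasDerivAt_c hX s)
    (fun s _ => ((hasDerivAt_id s).const_mul (5 * M)).congr_deriv (by simp))
    (fun s _ => ((hasDerivAt_id s).const_mul μ).congr_deriv (by simp))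
    (fun s hs => by
      have hc0 : 0 ≤ X s 2 := c_nonneg hX h0 hs.1
      have hb : |X s 1| ≤ 5 * ε := (bc_small hX h0 hε hε1 hM0 hs).1
      have ha : X s 0 ^ 2 ≤ 1 := traj_sq_le_one hX h0 s 0
      have hexp : exp (-(5 * M * s)) ≤ 1 := by
        rw [exp_le_one_iff, neg_nonpos]; have := hs.1; positivity
      have hk : 0 ≤ M := hM0
      have h1 : ε ^ 2 * exp (-M) * X s 0 ^ 2 ≤ μ := by
        simpa [hμ] using mul_le_mul_of_nonneg_left ha (by positivity : 0 ≤ ε ^ 2 * exp (-M))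
      have h2 : ε⁻¹ * M * X s 1 * X s 2 ≤ 5 * M * X s 2 := by
        have hb' : X s 1 ≤ 5 * ε := (le_abs_self _).trans hb
        have h5 : ε⁻¹ * X s 1 ≤ 5 := by
          rw [inv_mul_le_iff₀ hε]; linarith
        have : ε⁻¹ * M * X s 1 * X s 2 = (ε⁻¹ * X s 1) * (M * X s 2) := by ring
        rw [this]
        nlinarith [mul_nonneg hk hc0]
      have hbr : ε ^ 2 * exp (-M) * X s 0 ^ 2 + ε⁻¹ * M * X s 1 * X s 2
          - 5 * M * X s 2 ≤ μ := by linarith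
      calc (ε ^ 2 * exp (-M) * X s 0 ^ 2 + ε⁻¹ * M * X s 1 * X s 2
            - 5 * M * X s 2) * exp (-(5 * M * s))
          ≤ μ * exp (-(5 * M * s)) := mul_le_mul_of_nonneg_right hbr (exp_pos _).le
        _ ≤ μ * 1 := mul_le_mul_of_nonneg_left hexp hμ0
        _ = μ := mul_one _)
  have h0mem : (0 : ℝ) ∈ Icc (0 : ℝ) 2 := ⟨le_rfl, by norm_num⟩
  have h := hanti h0mem ht ht.1
  simp only [init_c h0, mul_zero, neg_zero, exp_zero, mul_one, sub_zero] at h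
  -- `c t * exp(-5Mt) - μ t ≤ κ`
  have h' : X t 2 * exp (-(5 * M * t)) ≤ κ + μ * 2 := by
    have := mul_le_mul_of_nonneg_left ht.2 hμ0; linarith
  have hexp : X t 2 = X t 2 * exp (-(5 * M * t)) * exp (5 * M * t) := by
    rw [mul_assoc, ← exp_add, neg_add_cancel, exp_zero, mul_one]
  rw [hexp]
  have hee : exp M * exp (-M) = 1 := by rw [← exp_add, add_neg_cancel, exp_zero]
  calc X t 2 * exp (-(5 * M * t)) * exp (5 * M * t)
      ≤ (κ + μ * 2) * exp (5 * M * t) := mul_le_mul_of_nonneg_right h' (exp_pos _).le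
    _ = (κ * exp M + 2 * ε ^ 2) * exp ((5 * t - 1) * M) := by
        simp only [hμ]
        rw [show (5 * t - 1) * M = -M + 5 * M * t by ring, exp_add]
        linear_combination (-(κ * exp (5 * M * t))) * hee

end Trajectory


section PhaseOne

/-! ## Up to the critical time: (dora), (able2), (bogo-2) and the sharp comparison for `c`

Throughout, `τ` is a time with `c ≤ K⁻¹⁰ε²` on `[0,τ]` ((boots); it will be the hitting time). -/

variable {K M ε κ τ : ℝ} {X : ℝ → Fin 5 → ℝ}

/-- (dora): `|d|, |ã| ≤ 3K⁻¹⁰` on `[0,τ]`, from `∂ₜ(d²+ã²) = 2ε⁻²c·a·d` applied to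
`√(d²+ã²+K⁻²⁰)`. [cite: Tao2016AveragedNS, §5.5 (dora)] -/
theorem de_small (hX : ∀ t, HasDerivAt X (delayCircuitWith K M ε (X t)) t) (h0 : IsKickedWith K M ε κ X)
    (hε : 0 < ε) (hK : 0 < K) (hτ2 : τ ≤ 2)
    (hcτ : ∀ t, 0 ≤ t → t ≤ τ → X t 2 ≤ ε ^ 2 / K ^ 10)
    {t : ℝ} (ht : t ∈ Icc 0 τ) : |X t 3| ≤ 3 / K ^ 10 ∧ |X t 4| ≤ 3 / K ^ 10 := by
  set q : ℝ := (K ^ 10)⁻¹ with hq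
  have hq0 : 0 < q := by positivity
  set u : ℝ → ℝ := fun s => X s 3 ^ 2 + X s 4 ^ 2 with hu
  set h : ℝ → ℝ := fun s => sqrt (u s + q ^ 2) with hh
  have hupos : ∀ s, 0 < u s + q ^ 2 := fun s => by positivity
  have hd_le : ∀ s, |X s 3| ≤ h s := fun s =>
    abs_le_sqrt (by simp only [hu]; nlinarith [sq_nonneg (X s 4)])
  have he_le : ∀ s, |X s 4| ≤ h s := fun s =>
    abs_le_sqrt (by simp only [hu]; nlinarith [sq_nonneg (X s 3)])
  have hder : ∀ s, HasDerivAt h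
      ((2 * (ε ^ 2)⁻¹ * X s 2 * X s 0 * X s 3) / (2 * sqrt (u s + q ^ 2))) s := fun s =>
    ((delayCircuitWith_out_energy (hX s)).add_const (q ^ 2)).sqrt (hupos s).ne'
  have hbound : ∀ s ∈ Icc 0 τ,
      (2 * (ε ^ 2)⁻¹ * X s 2 * X s 0 * X s 3) / (2 * sqrt (u s + q ^ 2)) ≤ q := by
    intro s hs
    have hhpos : 0 < sqrt (u s + q ^ 2) := sqrt_pos.2 (hupos s)
    rw [div_le_iff₀ (by positivity)]
    have hc0 : 0 ≤ X s 2 := c_nonneg hX h0 hs.1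
    have hcθ : X s 2 ≤ ε ^ 2 / K ^ 10 := hcτ s hs.1 hs.2
    have ha : |X s 0| ≤ 1 := traj_abs_le_one hX h0 s 0
    have hds : |X s 3| ≤ h s := hd_le s
    have hh' : h s = sqrt (u s + q ^ 2) := rfl
    rw [← hh']
    have h1 : |X s 0 * X s 3| ≤ h s := by
      rw [abs_mul]
      calc |X s 0| * |X s 3| ≤ 1 * h s := mul_le_mul ha hds (abs_nonneg _) zero_le_one
        _ = h s := one_mul _
    have h2 : (ε ^ 2)⁻¹ * X s 2 ≤ q := by
      calc (ε ^ 2)⁻¹ * X s 2 ≤ (ε ^ 2)⁻¹ * (ε ^ 2 / K ^ 10) :=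
            mul_le_mul_of_nonneg_left hcθ (by positivity)
        _ = q := by simp only [hq]; field_simp
    have h3 : 0 ≤ (ε ^ 2)⁻¹ * X s 2 := by positivity
    have h4 : (ε ^ 2)⁻¹ * X s 2 * (X s 0 * X s 3) ≤ q * h s :=
      calc (ε ^ 2)⁻¹ * X s 2 * (X s 0 * X s 3) ≤ (ε ^ 2)⁻¹ * X s 2 * |X s 0 * X s 3| :=
            mul_le_mul_of_nonneg_left (le_abs_self _) h3
        _ ≤ q * h s := mul_le_mul h2 h1 (abs_nonneg _) hq0.le
    have : 2 * (ε ^ 2)⁻¹ * X s 2 * X s 0 * X s 3 = 2 * ((ε ^ 2)⁻¹ * X s 2 * (X s 0 * X s 3)) := by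
      ring
    rw [this]
    linarith
  have hanti := antitoneOn_sub_of_deriv_le (Φ := fun s => q * s) (convex_Icc 0 τ)
    (fun s _ => hder s) (fun s _ => ((hasDerivAt_id s).const_mul q).congr_deriv (by simp)) hbound
  have h0mem : (0 : ℝ) ∈ Icc (0 : ℝ) τ := ⟨le_rfl, ht.1.trans ht.2⟩
  have hmono := hanti h0mem ht ht.1
  have hh0 : h 0 = q := by
    simp only [hh, hu, init_d h0, init_e h0]
    simpa using sqrt_sq hq0.le
  simp only [hh0, mul_zero, sub_zero] at hmono
  have hht : h t ≤ 3 / K ^ 10 := by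
    have ht2 : t ≤ 2 := ht.2.trans hτ2
    have : h t ≤ q + q * t := by linarith
    calc h t ≤ q + q * t := this
      _ ≤ q + q * 2 := by nlinarith
      _ = 3 / K ^ 10 := by simp only [hq]; ring
  exact ⟨(hd_le t).trans hht, (he_le t).trans hht⟩

/-- (able2) for `a`: `|a - 1| ≤ 8K⁻²⁰` on `[0,τ]` (from `∂ₜa = O(K⁻²⁰) + O(ε²)`; the initial offset
`|a(0) - 1| ≤ κ ≤ ε²/2` is absorbed by bounding the pump term by `ε²c ≤ ε⁴` instead of `ε²`).
[cite: Tao2016AveragedNS, §5.5 (able2)] -/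
theorem a_near_one (hX : ∀ t, HasDerivAt X (delayCircuitWith K M ε (X t)) t) (h0 : IsKickedWith K M ε κ X)
    (hε : 0 < ε) (hε1 : ε ≤ 1) (hM0 : 0 ≤ M) (hK : 1 ≤ K) (hτ2 : τ ≤ 2)
    (hεK : ε ^ 2 ≤ 1 / (6 * K ^ 20))
    (hcτ : ∀ t, 0 ≤ t → t ≤ τ → X t 2 ≤ ε ^ 2 / K ^ 10)
    {t : ℝ} (ht : t ∈ Icc 0 τ) : |X t 0 - 1| ≤ 8 / K ^ 20 := by
  have hK0 : 0 < K := by linarith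
  have h6 : 6 * ε ^ 2 ≤ 1 / K ^ 20 := by
    have := hεK
    rw [le_div_iff₀ (by positivity)] at this
    rw [le_div_iff₀ (by positivity)]
    linarith
  have hε6 : ε ^ 2 ≤ 1 / 6 := by
    have hK20 : (1 : ℝ) ≤ K ^ 20 := one_le_pow₀ hK
    calc ε ^ 2 ≤ 1 / (6 * K ^ 20) := hεK
      _ ≤ 1 / 6 := one_div_le_one_div_of_le (by norm_num) (by nlinarith)
  have hM : ∀ s ∈ Icc 0 τ, |(-((ε ^ 2)⁻¹ * X s 2 * X s 3) - ε * X s 0 * X s 1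
      - ε ^ 2 * exp (-M) * X s 0 * X s 2)| ≤ 3 / K ^ 20 + 31 * ε ^ 2 / 6 := by
    intro s hs
    have hs2 : s ∈ Icc (0 : ℝ) 2 := ⟨hs.1, hs.2.trans hτ2⟩
    have hc0 : 0 ≤ X s 2 := c_nonneg hX h0 hs.1
    have hcθ : X s 2 ≤ ε ^ 2 / K ^ 10 := hcτ s hs.1 hs.2
    have hd : |X s 3| ≤ 3 / K ^ 10 := (de_small hX h0 hε hK0 hτ2 hcτ hs).1
    have ha : |X s 0| ≤ 1 := traj_abs_le_one hX h0 s 0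
    have hb : |X s 1| ≤ 5 * ε := (bc_small hX h0 hε hε1 hM0 hs2).1
    have hc1 : |X s 2| ≤ 1 := traj_abs_le_one hX h0 s 2
    have hek : exp (-M) ≤ 1 := by rw [exp_le_one_iff, neg_nonpos]; exact hM0
    -- term 1: `|ρ c d| ≤ 3 K⁻²⁰`
    have h1 : |(ε ^ 2)⁻¹ * X s 2 * X s 3| ≤ 3 / K ^ 20 := by
      rw [abs_mul, abs_of_nonneg (by positivity : 0 ≤ (ε ^ 2)⁻¹ * X s 2)]
      calc (ε ^ 2)⁻¹ * X s 2 * |X s 3| ≤ (ε ^ 2)⁻¹ * (ε ^ 2 / K ^ 10) * (3 / K ^ 10) :=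
            mul_le_mul (mul_le_mul_of_nonneg_left hcθ (by positivity)) hd (abs_nonneg _)
              (by positivity)
        _ = 3 / K ^ 20 := by field_simp
    -- term 2: `|ε a b| ≤ 5ε²`
    have h2 : |ε * X s 0 * X s 1| ≤ 5 * ε ^ 2 := by
      rw [abs_mul, abs_mul, abs_of_pos hε]
      calc ε * |X s 0| * |X s 1| ≤ ε * 1 * (5 * ε) :=
            mul_le_mul (mul_le_mul_of_nonneg_left ha hε.le) hb (abs_nonneg _) (by positivity)
        _ = 5 * ε ^ 2 := by ring
    -- term 3: `|μ a c| ≤ ε²·c ≤ ε⁴K⁻¹⁰ ≤ ε²/6` (on `[0,τ]` the trigger mode is below `K⁻¹⁰ε²`)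
    have h3 : |ε ^ 2 * exp (-M) * X s 0 * X s 2| ≤ ε ^ 2 / 6 := by
      rw [abs_mul, abs_mul, abs_mul, abs_of_pos (pow_pos hε 2), abs_of_pos (exp_pos _),
        abs_of_nonneg hc0]
      have hcK : X s 2 ≤ ε ^ 2 := hcθ.trans (div_le_self (sq_nonneg ε) (one_le_pow₀ hK))
      calc ε ^ 2 * exp (-M) * |X s 0| * X s 2 ≤ ε ^ 2 * 1 * 1 * ε ^ 2 :=
            mul_le_mul (mul_le_mul (mul_le_mul_of_nonneg_left hek (by positivity)) ha
              (abs_nonneg _) (by positivity)) hcK hc0 (by positivity)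
        _ ≤ ε ^ 2 * 1 * 1 * (1 / 6) := mul_le_mul_of_nonneg_left hε6 (by positivity)
        _ = ε ^ 2 / 6 := by ring
    calc |(-((ε ^ 2)⁻¹ * X s 2 * X s 3) - ε * X s 0 * X s 1 - ε ^ 2 * exp (-M) * X s 0 * X s 2)|
        ≤ |(-((ε ^ 2)⁻¹ * X s 2 * X s 3) - ε * X s 0 * X s 1)|
          + |ε ^ 2 * exp (-M) * X s 0 * X s 2| := abs_sub _ _
      _ ≤ |(-((ε ^ 2)⁻¹ * X s 2 * X s 3))| + |ε * X s 0 * X s 1|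
          + |ε ^ 2 * exp (-M) * X s 0 * X s 2| := by
          have := abs_sub (-((ε ^ 2)⁻¹ * X s 2 * X s 3)) (ε * X s 0 * X s 1)
          linarith
      _ ≤ 3 / K ^ 20 + 5 * ε ^ 2 + ε ^ 2 / 6 := by rw [abs_neg]; linarith
      _ = 3 / K ^ 20 + 31 * ε ^ 2 / 6 := by ring
  have := abs_sub_le_of_abs_deriv_le (fun s _ => hasDerivAt_a hX s) hM ht
  rw [sub_zero] at this
  have ha0 : |X 0 0 - 1| ≤ κ := init_a_near h0
  have ht2 : t ≤ 2 := ht.2.trans hτ2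
  calc |X t 0 - 1| ≤ |X t 0 - X 0 0| + |X 0 0 - 1| := abs_sub_le _ _ _
    _ ≤ (3 / K ^ 20 + 31 * ε ^ 2 / 6) * t + κ := add_le_add this ha0
    _ ≤ (3 / K ^ 20 + 31 * ε ^ 2 / 6) * 2 + ε ^ 2 / 2 :=
        add_le_add (mul_le_mul_of_nonneg_left ht2 (by positivity)) h0.le_half_sq
    _ = 6 / K ^ 20 + 65 * ε ^ 2 / 6 := by ring
    _ ≤ 6 / K ^ 20 + 2 * (6 * ε ^ 2) := by nlinarith [sq_nonneg ε]
    _ ≤ 6 / K ^ 20 + 2 * (1 / K ^ 20) := by linarith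
    _ = 8 / K ^ 20 := by ring

/-- (bogo-2): `|b - εt| ≤ 17εt·K⁻²⁰` on `[0,τ]` (from `∂ₜb = ε + O(K⁻²⁰ε) + O(K⁻¹⁰ε³)`).
[cite: Tao2016AveragedNS, §5.5 (bogo-2)] -/
theorem b_linear (hX : ∀ t, HasDerivAt X (delayCircuitWith K M ε (X t)) t) (h0 : IsKickedWith K M ε κ X)
    (hε : 0 < ε) (hε1 : ε ≤ 1) (hM0 : 0 < M) (hMK : M ≤ K ^ 10) (hK : 1 ≤ K) (hτ2 : τ ≤ 2)
    (hεK : ε ^ 2 ≤ 1 / (6 * K ^ 20))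
    (hcτ : ∀ t, 0 ≤ t → t ≤ τ → X t 2 ≤ ε ^ 2 / K ^ 10)
    {t : ℝ} (ht : t ∈ Icc 0 τ) : |X t 1 - ε * t| ≤ 17 * ε / K ^ 20 * t := by
  have hK0 : 0 < K := by linarith
  have hM : ∀ s ∈ Icc 0 τ,
      |ε * X s 0 ^ 2 - ε⁻¹ * M * X s 2 ^ 2 - ε * 1| ≤ 17 * ε / K ^ 20 := by
    intro s hs
    have hc0 : 0 ≤ X s 2 := c_nonneg hX h0 hs.1
    have hcθ : X s 2 ≤ ε ^ 2 / K ^ 10 := hcτ s hs.1 hs.2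
    have ha1 : |X s 0 - 1| ≤ 8 / K ^ 20 := a_near_one hX h0 hε hε1 hM0.le hK hτ2 hεK hcτ hs
    have ha : |X s 0| ≤ 1 := traj_abs_le_one hX h0 s 0
    -- `|ε (a² - 1)| ≤ 16 ε K⁻²⁰`
    have h1 : |ε * (X s 0 ^ 2 - 1)| ≤ 16 * ε / K ^ 20 := by
      rw [abs_mul, abs_of_pos hε, show X s 0 ^ 2 - 1 = (X s 0 - 1) * (X s 0 + 1) by ring, abs_mul]
      have hp1 : |X s 0 + 1| ≤ 2 := by
        calc |X s 0 + 1| ≤ |X s 0| + |1| := abs_add_le _ _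
          _ ≤ 1 + 1 := by rw [abs_one]; linarith
          _ = 2 := by norm_num
      calc ε * (|X s 0 - 1| * |X s 0 + 1|) ≤ ε * (8 / K ^ 20 * 2) :=
            mul_le_mul_of_nonneg_left (mul_le_mul ha1 hp1 (abs_nonneg _) (by positivity)) hε.le
        _ = 16 * ε / K ^ 20 := by ring
    -- `0 ≤ ν c² ≤ M ε³ K⁻²⁰ ≤ ε K⁻²⁰` (`M ε² ≤ K¹⁰ε² ≤ 1`)
    have h2 : 0 ≤ ε⁻¹ * M * X s 2 ^ 2 := by
      have := hM0.le
      positivity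
    have h3 : ε⁻¹ * M * X s 2 ^ 2 ≤ ε / K ^ 20 := by
      have hc2 : X s 2 ^ 2 ≤ (ε ^ 2 / K ^ 10) ^ 2 := pow_le_pow_left₀ hc0 hcθ 2
      have hMε : M * ε ^ 2 ≤ 1 := by
        have hK20 : (1 : ℝ) ≤ K ^ 20 := one_le_pow₀ hK
        calc M * ε ^ 2 ≤ K ^ 10 * (1 / (6 * K ^ 20)) :=
              mul_le_mul hMK hεK (by positivity) (by positivity)
          _ = K ^ 10 / K ^ 20 / 6 := by field_simp
          _ ≤ 1 / 1 / 6 := by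
              have : K ^ 10 / K ^ 20 ≤ 1 := by
                rw [div_le_one (by positivity)]
                exact pow_le_pow_right₀ hK (by norm_num)
              linarith
          _ ≤ 1 := by norm_num
      calc ε⁻¹ * M * X s 2 ^ 2 ≤ ε⁻¹ * M * (ε ^ 2 / K ^ 10) ^ 2 :=
            mul_le_mul_of_nonneg_left hc2 (by have := hM0.le; positivity)
        _ = ε * (M * ε ^ 2) / K ^ 20 := by field_simp
        _ ≤ ε * 1 / K ^ 20 := by
            exact div_le_div_of_nonneg_right (mul_le_mul_of_nonneg_left hMε hε.le) (by positivity)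
        _ = ε / K ^ 20 := by ring
    rw [show ε * X s 0 ^ 2 - ε⁻¹ * M * X s 2 ^ 2 - ε * 1
        = ε * (X s 0 ^ 2 - 1) - ε⁻¹ * M * X s 2 ^ 2 by ring]
    calc |ε * (X s 0 ^ 2 - 1) - ε⁻¹ * M * X s 2 ^ 2|
        ≤ |ε * (X s 0 ^ 2 - 1)| + |ε⁻¹ * M * X s 2 ^ 2| := abs_sub _ _
      _ ≤ 16 * ε / K ^ 20 + ε / K ^ 20 := by rw [abs_of_nonneg h2]; linarith
      _ = 17 * ε / K ^ 20 := by ring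
  have hder : ∀ s ∈ Icc 0 τ, HasDerivAt (fun r => X r 1 - ε * r)
      (ε * X s 0 ^ 2 - ε⁻¹ * M * X s 2 ^ 2 - ε * 1) s := fun s _ =>
    (hasDerivAt_b hX s).sub ((hasDerivAt_id s).const_mul ε)
  have := abs_sub_le_of_abs_deriv_le hder hM ht
  simpa [init_b h0] using this

/-- Sharp super-solution for `c` on `[0,τ]`, kicked datum: `c(t) ≤ (κe^{M} + 2ε²) exp(Mt²/2 + 1 - M)`
(integrating
factor `exp(-(Mt²/2 + βt))`, `β = 34M K⁻²⁰ ≤ 34K⁻¹⁰`). [cite: Tao2016AveragedNS, §5.5 proof of (tcable)] -/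
theorem c_upper_sharp (hX : ∀ t, HasDerivAt X (delayCircuitWith K M ε (X t)) t) (h0 : IsKickedWith K M ε κ X)
    (hε : 0 < ε) (hε1 : ε ≤ 1) (hM0 : 0 < M) (hMK : M ≤ K ^ 10) (hK : 2 ≤ K) (hτ2 : τ ≤ 2)
    (hεK : ε ^ 2 ≤ 1 / (6 * K ^ 20))
    (hcτ : ∀ t, 0 ≤ t → t ≤ τ → X t 2 ≤ ε ^ 2 / K ^ 10)
    {t : ℝ} (ht : t ∈ Icc 0 τ) :
    X t 2 ≤ (κ * exp M + 2 * ε ^ 2) * exp (M * t ^ 2 / 2 + 1 - M) := by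
  have hK0 : 0 < K := by linarith
  have hκ0 : 0 ≤ κ := h0.nonneg
  have hK1 : 1 ≤ K := by linarith
  have hK68 : 68 ≤ K ^ 10 := by
    have : (2 : ℝ) ^ 10 ≤ K ^ 10 := pow_le_pow_left₀ (by norm_num) hK 10
    nlinarith
  set β : ℝ := 34 * M / K ^ 20 with hβ
  have hβ0 : 0 ≤ β := by positivity
  have hβ1 : β ≤ 1 / 2 := by
    simp only [hβ]; rw [div_le_div_iff₀ (by positivity) (by norm_num)]
    have : K ^ 20 = K ^ 10 * K ^ 10 := by ring
    nlinarith [pow_pos hK0 10]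
  set k : ℝ := M with hk
  have hk0 : 0 < k := hM0
  set μ : ℝ := ε ^ 2 * exp (-k) with hμ
  have hμ0 : 0 ≤ μ := by positivity
  -- integrating factor `G(s) = k s²/2 + β s`
  have hG : ∀ s, HasDerivAt (fun r : ℝ => k / 2 * (r * r) + β * r) (k * s + β) s := by
    intro s
    have := (((hasDerivAt_id s).mul (hasDerivAt_id s)).const_mul (k / 2)).add
      ((hasDerivAt_id s).const_mul β)
    exact this.congr_deriv (by simp; ring)
  have hanti := antitoneOn_intFactor (s := Icc 0 τ) (g := fun s => k * s + β)
    (G := fun r => k / 2 * (r * r) + β * r) (φ := fun _ => μ) (Φ := fun s => μ * s)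
    (convex_Icc 0 τ) (fun s _ => hasDerivAt_c hX s) (fun s _ => hG s)
    (fun s _ => ((hasDerivAt_id s).const_mul μ).congr_deriv (by simp))
    (fun s hs => by
      have hc0 : 0 ≤ X s 2 := c_nonneg hX h0 hs.1
      have ha : X s 0 ^ 2 ≤ 1 := traj_sq_le_one hX h0 s 0
      have hb : |X s 1 - ε * s| ≤ 17 * ε / K ^ 20 * s :=
        b_linear hX h0 hε hε1 hM0 hMK hK1 hτ2 hεK hcτ hs
      have hs2 : s ≤ 2 := hs.2.trans hτ2
      -- `ν b ≤ k s + β`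
      have hνb : ε⁻¹ * M * X s 1 ≤ k * s + β := by
        have hb' : X s 1 ≤ ε * s + 17 * ε / K ^ 20 * s := by
          have := (abs_le.1 hb).2; linarith
        have h34 : 17 * ε / K ^ 20 * s ≤ 34 * ε / K ^ 20 := by
          have h2s : 17 * ε / K ^ 20 * s ≤ 17 * ε / K ^ 20 * 2 :=
            mul_le_mul_of_nonneg_left hs2 (by positivity)
          have h2e : 17 * ε / K ^ 20 * 2 = 34 * ε / K ^ 20 := by ring
          linarith
        calc ε⁻¹ * M * X s 1 ≤ ε⁻¹ * M * (ε * s + 34 * ε / K ^ 20) :=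
              mul_le_mul_of_nonneg_left (by linarith) (by positivity)
          _ = k * s + β := by
              simp only [hβ, hk]; field_simp
      have hexp : exp (-(k / 2 * (s * s) + β * s)) ≤ 1 := by
        rw [exp_le_one_iff, neg_nonpos]; have := hs.1; positivity
      have hbr : ε ^ 2 * exp (-M) * X s 0 ^ 2 + ε⁻¹ * M * X s 1 * X s 2
          - (k * s + β) * X s 2 ≤ μ := by
        have h1 : ε ^ 2 * exp (-M) * X s 0 ^ 2 ≤ μ := by
          simpa [hμ, hk] using mul_le_mul_of_nonneg_left ha
            (by positivity : 0 ≤ ε ^ 2 * exp (-M))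
        have h2 : ε⁻¹ * M * X s 1 * X s 2 ≤ (k * s + β) * X s 2 :=
          mul_le_mul_of_nonneg_right hνb hc0
        linarith
      calc (ε ^ 2 * exp (-M) * X s 0 ^ 2 + ε⁻¹ * M * X s 1 * X s 2
            - (k * s + β) * X s 2) * exp (-(k / 2 * (s * s) + β * s))
          ≤ μ * exp (-(k / 2 * (s * s) + β * s)) :=
            mul_le_mul_of_nonneg_right hbr (exp_pos _).le
        _ ≤ μ * 1 := mul_le_mul_of_nonneg_left hexp hμ0
        _ = μ := mul_one _)
  have h0mem : (0 : ℝ) ∈ Icc (0 : ℝ) τ := ⟨le_rfl, ht.1.trans ht.2⟩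
  have h := hanti h0mem ht ht.1
  simp only [init_c h0, mul_zero, sub_zero, add_zero, neg_zero, exp_zero, mul_one] at h
  have h' : X t 2 * exp (-(k / 2 * (t * t) + β * t)) ≤ κ + μ * t := by linarith
  have ht2 : t ≤ 2 := ht.2.trans hτ2
  have hE : X t 2 = X t 2 * exp (-(k / 2 * (t * t) + β * t)) * exp (k / 2 * (t * t) + β * t) := by
    rw [mul_assoc, ← exp_add, neg_add_cancel, exp_zero, mul_one]
  rw [hE]
  have hee : exp M * exp (-M) = 1 := by rw [← exp_add, add_neg_cancel, exp_zero]
  calc X t 2 * exp (-(k / 2 * (t * t) + β * t)) * exp (k / 2 * (t * t) + β * t)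
      ≤ (κ + μ * t) * exp (k / 2 * (t * t) + β * t) := mul_le_mul_of_nonneg_right h' (exp_pos _).le
    _ ≤ (κ + μ * 2) * exp (k / 2 * (t * t) + 1) := by
        have hβt : β * t ≤ 1 := by nlinarith
        have hμt : μ * t ≤ μ * 2 := mul_le_mul_of_nonneg_left ht2 hμ0
        exact mul_le_mul (by linarith) (exp_le_exp.2 (by linarith))
          (exp_pos _).le (add_nonneg hκ0 (by positivity))
    _ = (κ * exp M + 2 * ε ^ 2) * exp (M * t ^ 2 / 2 + 1 - M) := by
        simp only [hμ, hk]
        rw [show M * t ^ 2 / 2 + 1 - M = -M + (M / 2 * (t * t) + 1) by ring,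
          exp_add (-M)]
        linear_combination (-(κ * exp (M / 2 * (t * t) + 1))) * hee

/-- Sharp sub-solution for `c` on `[K⁻⁵, τ]` (needs `K⁻⁵ ≤ τ`):
`c(t) ≥ (ε²/(4K⁵)) exp(Mt²/2 - 1 - M)` (integrating factor `exp(-(Mt²/2 - βt))`, first on
`[0,K⁻⁵]` where it is `≥ e^{-1/2}` because `M K⁻¹⁰ ≤ 1`, then on `[K⁻⁵,τ]`).
[cite: Tao2016AveragedNS, §5.5 proof of (tcable)] -/
theorem c_lower_sharp (hX : ∀ t, HasDerivAt X (delayCircuitWith K M ε (X t)) t) (h0 : IsKickedWith K M ε κ X)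
    (hε : 0 < ε) (hε1 : ε ≤ 1) (hM0 : 0 < M) (hMK : M ≤ K ^ 10) (hK : 2 ≤ K) (hτ2 : τ ≤ 2)
    (hτ5 : (K ^ 5)⁻¹ ≤ τ)
    (hεK : ε ^ 2 ≤ 1 / (6 * K ^ 20))
    (hcτ : ∀ t, 0 ≤ t → t ≤ τ → X t 2 ≤ ε ^ 2 / K ^ 10)
    {t : ℝ} (ht : t ∈ Icc (K ^ 5)⁻¹ τ) :
    ε ^ 2 / (4 * K ^ 5) * exp (M * t ^ 2 / 2 - 1 - M) ≤ X t 2 := by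
  have hK0 : 0 < K := by linarith
  have hK1 : 1 ≤ K := by linarith
  have hK68 : 68 ≤ K ^ 10 := by
    have : (2 : ℝ) ^ 10 ≤ K ^ 10 := pow_le_pow_left₀ (by norm_num) hK 10
    nlinarith
  set β : ℝ := 34 * M / K ^ 20 with hβ
  have hβ0 : 0 ≤ β := by positivity
  have hβ1 : β ≤ 1 / 2 := by
    simp only [hβ]; rw [div_le_div_iff₀ (by positivity) (by norm_num)]
    have : K ^ 20 = K ^ 10 * K ^ 10 := by ring
    nlinarith [pow_pos hK0 10]
  have hks₀' : M * ((K ^ 5)⁻¹ * (K ^ 5)⁻¹) ≤ 1 := by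
    rw [← mul_inv, ← pow_add, show (5 + 5 : ℕ) = 10 from rfl, ← div_eq_mul_inv,
      div_le_one (by positivity)]
    exact hMK
  set k : ℝ := M with hk
  have hk0 : 0 < k := hM0
  set μ : ℝ := ε ^ 2 * exp (-k) with hμ
  have hμ0 : 0 ≤ μ := by positivity
  set s₀ : ℝ := (K ^ 5)⁻¹ with hs₀
  have hs₀0 : 0 < s₀ := by positivity
  have hks₀ : k * (s₀ * s₀) ≤ 1 := hks₀'
  -- integrating factor `G(s) = k s²/2 - β s`
  have hG : ∀ s, HasDerivAt (fun r : ℝ => k / 2 * (r * r) - β * r) (k * s - β) s := by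
    intro s
    have := (((hasDerivAt_id s).mul (hasDerivAt_id s)).const_mul (k / 2)).sub
      ((hasDerivAt_id s).const_mul β)
    exact this.congr_deriv (by simp; ring)
  -- the bracket `(c' - (ks-β)c) e^{-G} ≥ (μ/2) e^{-G}` on `[0,τ]`
  have hbr : ∀ s ∈ Icc 0 τ, μ / 2 * exp (-(k / 2 * (s * s) - β * s)) ≤
      (ε ^ 2 * exp (-M) * X s 0 ^ 2 + ε⁻¹ * M * X s 1 * X s 2
        - (k * s - β) * X s 2) * exp (-(k / 2 * (s * s) - β * s)) := by
    intro s hs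
    have hc0 : 0 ≤ X s 2 := c_nonneg hX h0 hs.1
    have ha1 : |X s 0 - 1| ≤ 8 / K ^ 20 := a_near_one hX h0 hε hε1 hM0.le hK1 hτ2 hεK hcτ hs
    have hb : |X s 1 - ε * s| ≤ 17 * ε / K ^ 20 * s :=
      b_linear hX h0 hε hε1 hM0 hMK hK1 hτ2 hεK hcτ hs
    have hs2 : s ≤ 2 := hs.2.trans hτ2
    -- `a² ≥ 1/2`
    have hK20 : 8 / K ^ 20 ≤ 1 / 4 := by
      rw [div_le_div_iff₀ (by positivity) (by norm_num)]
      have : (2 : ℝ) ^ 20 ≤ K ^ 20 := pow_le_pow_left₀ (by norm_num) hK 20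
      nlinarith
    have ha_lo : 3 / 4 ≤ X s 0 := by have := (abs_le.1 ha1).1; linarith
    have ha2 : 1 / 2 ≤ X s 0 ^ 2 := by nlinarith
    -- `ν b ≥ k s - β`
    have hνb : k * s - β ≤ ε⁻¹ * M * X s 1 := by
      have hb' : ε * s - 17 * ε / K ^ 20 * s ≤ X s 1 := by
        have := (abs_le.1 hb).1; linarith
      have h34 : 17 * ε / K ^ 20 * s ≤ 34 * ε / K ^ 20 := by
        have h2s : 17 * ε / K ^ 20 * s ≤ 17 * ε / K ^ 20 * 2 :=
          mul_le_mul_of_nonneg_left hs2 (by positivity)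
        have h2e : 17 * ε / K ^ 20 * 2 = 34 * ε / K ^ 20 := by ring
        linarith
      calc k * s - β = ε⁻¹ * M * (ε * s - 34 * ε / K ^ 20) := by
            simp only [hβ, hk]; field_simp
        _ ≤ ε⁻¹ * M * X s 1 :=
            mul_le_mul_of_nonneg_left (by linarith) (by positivity)
    have h1 : μ / 2 ≤ ε ^ 2 * exp (-M) * X s 0 ^ 2 := by
      have : ε ^ 2 * exp (-M) * (1 / 2) ≤ ε ^ 2 * exp (-M) * X s 0 ^ 2 :=
        mul_le_mul_of_nonneg_left ha2 (by positivity)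
      simp only [hμ, hk] at this ⊢; linarith
    have h2 : (k * s - β) * X s 2 ≤ ε⁻¹ * M * X s 1 * X s 2 :=
      mul_le_mul_of_nonneg_right hνb hc0
    have hbr' : μ / 2 ≤ ε ^ 2 * exp (-M) * X s 0 ^ 2 + ε⁻¹ * M * X s 1 * X s 2
        - (k * s - β) * X s 2 := by linarith
    exact mul_le_mul_of_nonneg_right hbr' (exp_pos _).le
  -- Stage A: on `[0, s₀]`, `e^{-G} ≥ 1/2`, so `c e^{-G} - (μ/4) s` is monotone
  have hs₀τ : s₀ ≤ τ := hτ5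
  have hmonoA := monotoneOn_intFactor (s := Icc 0 s₀) (g := fun s => k * s - β)
    (G := fun r => k / 2 * (r * r) - β * r) (φ := fun _ => μ / 4) (Φ := fun s => μ / 4 * s)
    (convex_Icc 0 s₀) (fun s _ => hasDerivAt_c hX s) (fun s _ => hG s)
    (fun s _ => ((hasDerivAt_id s).const_mul (μ / 4)).congr_deriv (by simp))
    (fun s hs => by
      have hsτ : s ∈ Icc 0 τ := ⟨hs.1, hs.2.trans hs₀τ⟩
      have hexp : 1 / 2 ≤ exp (-(k / 2 * (s * s) - β * s)) := by
        have hss : k * (s * s) ≤ 1 := by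
          calc k * (s * s) ≤ k * (s₀ * s₀) := by
                exact mul_le_mul_of_nonneg_left (mul_self_le_mul_self hs.1 hs.2) hk0.le
            _ ≤ 1 := hks₀
        have harg : -(1 / 2 : ℝ) ≤ -(k / 2 * (s * s) - β * s) := by
          have : 0 ≤ β * s := mul_nonneg hβ0 hs.1
          linarith
        calc (1 / 2 : ℝ) ≤ exp (-(1 / 2 : ℝ)) := by
              have h := Real.add_one_le_exp (-(1 / 2 : ℝ))
              linarith
          _ ≤ exp (-(k / 2 * (s * s) - β * s)) := exp_le_exp.2 harg
      calc μ / 4 = μ / 2 * (1 / 2) := by ring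
        _ ≤ μ / 2 * exp (-(k / 2 * (s * s) - β * s)) :=
            mul_le_mul_of_nonneg_left hexp (by positivity)
        _ ≤ _ := hbr s hsτ)
  have hA := hmonoA (⟨le_rfl, hs₀0.le⟩ : (0 : ℝ) ∈ Icc 0 s₀) ⟨hs₀0.le, le_rfl⟩ hs₀0.le
  simp only [init_c h0, mul_zero, sub_zero, neg_zero, exp_zero, mul_one] at hA
  have hκ0 : 0 ≤ κ := h0.nonneg
  -- Stage B: on `[s₀, τ]`, `c e^{-G}` is monotone
  have hmonoB := monotoneOn_intFactor (s := Icc s₀ τ) (g := fun s => k * s - β)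
    (G := fun r => k / 2 * (r * r) - β * r) (φ := fun _ => 0) (Φ := fun _ => 0)
    (convex_Icc s₀ τ) (fun s _ => hasDerivAt_c hX s) (fun s _ => hG s)
    (fun s _ => hasDerivAt_const s (0 : ℝ))
    (fun s hs => by
      have hsτ : s ∈ Icc 0 τ := ⟨hs₀0.le.trans hs.1, hs.2⟩
      exact le_trans (by positivity) (hbr s hsτ))
  have hB := hmonoB (⟨le_rfl, hs₀τ⟩ : s₀ ∈ Icc s₀ τ) ht ht.1
  simp only [sub_zero] at hB
  -- combine: `c t e^{-G t} ≥ μ/4 s₀`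
  have hct : μ / 4 * s₀ ≤ X t 2 * exp (-(k / 2 * (t * t) - β * t)) := by linarith
  have ht0 : 0 ≤ t := hs₀0.le.trans ht.1
  have ht2 : t ≤ 2 := ht.2.trans hτ2
  have hE : X t 2 = X t 2 * exp (-(k / 2 * (t * t) - β * t)) * exp (k / 2 * (t * t) - β * t) := by
    rw [mul_assoc, ← exp_add, neg_add_cancel, exp_zero, mul_one]
  rw [hE]
  calc ε ^ 2 / (4 * K ^ 5) * exp (M * t ^ 2 / 2 - 1 - M)
      = μ / 4 * s₀ * exp (k / 2 * (t * t) - 1) := by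
        simp only [hμ, hk, hs₀]
        rw [show M * t ^ 2 / 2 - 1 - M = -M + (M / 2 * (t * t) - 1) by ring,
          exp_add (-M)]
        field_simp
    _ ≤ μ / 4 * s₀ * exp (k / 2 * (t * t) - β * t) := by
        have hβt : β * t ≤ 1 := by nlinarith
        exact mul_le_mul_of_nonneg_left (exp_le_exp.2 (by linarith)) (by positivity)
    _ ≤ X t 2 * exp (-(k / 2 * (t * t) - β * t)) * exp (k / 2 * (t * t) - β * t) :=
        mul_le_mul_of_nonneg_right hct (exp_pos _).le

end PhaseOne



section CriticalTime

/-! ## The critical window, read off from the hitting condition (no `K⁹` numerics) -/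

variable {K M ε κ τ : ℝ} {X : ℝ → Fin 5 → ℝ}


/-- **(tcable) and (c-bound) for the family, kicked datum.** If `τ` is the first hitting time of
the level `K⁻¹⁰ε²` by `c` on `[0,2]`, then `2 - 44 log K / M ≤ τ² ≤ 2 + 2/M` (so `1 ≤ τ ≤ 3/2`
once `88 log K ≤ M`) and `c(τ) = K⁻¹⁰ε²`. The lower edge is the super-solution evaluated at the
hitting time (`K⁻¹⁰ε² ≤ (κe^{M} + 2ε²)e^{Mτ²/2 + 1 - M} ≤ 3K¹⁰ε²e^{Mτ²/2 + 1 - M}` by the tolerance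
`κe^{M} ≤ K¹⁰ε²`, then `log`) — this is the ONLY place where the tolerance is spent, and it costs
the constant `24 ↦ 44`; the upper edge is the sub-solution at `T = √(2 + 2/M)` as before.
[cite: Tao2016AveragedNS, §5.5 (tcable), (c-bound)] -/
theorem tc_window (hX : ∀ t, HasDerivAt X (delayCircuitWith K M ε (X t)) t) (h0 : IsKickedWith K M ε κ X)
    (hε : 0 < ε) (hε1 : ε ≤ 1) (hM0 : 0 < M) (hMK : M ≤ K ^ 10) (hK : 16 ≤ K)
    (hML : 88 * Real.log K ≤ M) (hεK : ε ^ 2 ≤ 1 / (6 * K ^ 20))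
    (hτ0 : 0 < τ) (hτ2 : τ ≤ 2)
    (hcτ : ∀ t, 0 ≤ t → t ≤ τ → X t 2 ≤ ε ^ 2 / K ^ 10)
    (hτeq : τ < 2 → X τ 2 = ε ^ 2 / K ^ 10) :
    2 - 44 * Real.log K / M ≤ τ ^ 2 ∧ τ ^ 2 ≤ 2 + 2 / M ∧ 1 ≤ τ ∧ τ ≤ 3 / 2 ∧
      X τ 2 = ε ^ 2 / K ^ 10 := by
  have hK2 : 2 ≤ K := by linarith
  have hK0 : 0 < K := by linarith
  obtain ⟨hlog, hlog2, hlog0⟩ := log_facts hK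
  -- late side: `τ² ≤ 2 + 2/M`
  have hlate : τ ^ 2 ≤ 2 + 2 / M := by
    by_contra hlt'
    have hlt := not_le.1 hlt'
    set T := sqrt (2 + 2 / M) with hT
    have hT0 : 0 ≤ T := sqrt_nonneg _
    have hT2 : T ^ 2 = 2 + 2 / M := sq_sqrt (by positivity)
    have hTτ : T < τ := by
      rw [← hT2] at hlt
      exact lt_of_pow_lt_pow_left₀ 2 hτ0.le hlt
    have hT1 : 1 ≤ T := by
      rw [hT, le_sqrt (by norm_num) (by positivity)]
      have : 0 ≤ 2 / M := by positivity
      linarith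
    have hT5 : (K ^ 5)⁻¹ ≤ T := by
      have : (K ^ 5)⁻¹ ≤ 1 := inv_le_one_of_one_le₀ (one_le_pow₀ (by linarith))
      linarith
    have hτ5 : (K ^ 5)⁻¹ ≤ τ := by linarith
    have hlow := c_lower_sharp hX h0 hε hε1 hM0 hMK hK2 hτ2 hτ5 hεK hcτ (t := T) ⟨hT5, hTτ.le⟩
    have hcT : X T 2 ≤ ε ^ 2 / K ^ 10 := hcτ T (by linarith) hTτ.le
    have hexp0 : M * T ^ 2 / 2 - 1 - M = 0 := by rw [hT2]; field_simp; ring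
    rw [hexp0, exp_zero, mul_one] at hlow
    have h : ε ^ 2 / (4 * K ^ 5) ≤ ε ^ 2 / K ^ 10 := hlow.trans hcT
    rw [div_le_div_iff₀ (by positivity) (by positivity)] at h
    have hε2 : 0 < ε ^ 2 := by positivity
    have h' : K ^ 10 ≤ 4 * K ^ 5 := le_of_mul_le_mul_left (by linarith) hε2
    have h5 : (16 : ℝ) ^ 5 ≤ K ^ 5 := pow_le_pow_left₀ (by norm_num) hK 5
    nlinarith [pow_pos hK0 5]
  have hM96 : 96 ≤ M := by linarith
  have hτ32 : τ ≤ 3 / 2 := by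
    have h2M : 2 / M ≤ 1 / 4 := by
      rw [div_le_div_iff₀ hM0 (by norm_num)]; linarith
    nlinarith
  have hτlt2 : τ < 2 := by linarith
  have hcτeq := hτeq hτlt2
  -- early side: `2 - 44 log K / M ≤ τ²` (the tolerance is spent here)
  have hearly : 2 - 44 * Real.log K / M ≤ τ ^ 2 := by
    have hup := c_upper_sharp hX h0 hε hε1 hM0 hMK hK2 hτ2 hεK hcτ (t := τ) ⟨hτ0.le, le_rfl⟩
    rw [hcτeq] at hup
    -- the tolerance: `κe^{M} + 2ε² ≤ K¹⁰ε² + 2ε² ≤ 3K¹⁰ε²`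
    have hK10 : (1 : ℝ) ≤ K ^ 10 := one_le_pow₀ (by linarith)
    have hlam : κ * exp M + 2 * ε ^ 2 ≤ 3 * K ^ 10 * ε ^ 2 := by
      have := h0.le_tol; nlinarith [sq_nonneg ε]
    have hup' : ε ^ 2 / K ^ 10 ≤ 3 * K ^ 10 * ε ^ 2 * exp (M * τ ^ 2 / 2 + 1 - M) :=
      hup.trans (mul_le_mul_of_nonneg_right hlam (exp_pos _).le)
    -- `1/(3K²⁰) ≤ exp(Mτ²/2 + 1 - M)`
    have h1 : 1 / (3 * K ^ 20) ≤ exp (M * τ ^ 2 / 2 + 1 - M) := by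
      rw [div_le_iff₀ (by positivity)]
      have hε2 : 0 < ε ^ 2 := by positivity
      have : ε ^ 2 * 1 ≤ ε ^ 2 * (exp (M * τ ^ 2 / 2 + 1 - M) * (3 * K ^ 20)) := by
        calc ε ^ 2 * 1 = ε ^ 2 / K ^ 10 * K ^ 10 := by field_simp
          _ ≤ 3 * K ^ 10 * ε ^ 2 * exp (M * τ ^ 2 / 2 + 1 - M) * K ^ 10 :=
              mul_le_mul_of_nonneg_right hup' (by positivity)
          _ = ε ^ 2 * (exp (M * τ ^ 2 / 2 + 1 - M) * (3 * K ^ 20)) := by ring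
      exact le_of_mul_le_mul_left this hε2
    have h2 : Real.log (1 / (3 * K ^ 20)) ≤ M * τ ^ 2 / 2 + 1 - M := by
      have := Real.log_le_log (by positivity) h1
      rwa [Real.log_exp] at this
    have h3 : Real.log (1 / (3 * K ^ 20)) = -(Real.log 3 + 20 * Real.log K) := by
      rw [one_div, Real.log_inv, Real.log_mul (by norm_num) (by positivity), Real.log_pow]
      push_cast; ring
    rw [h3] at h2
    have hlog3 : Real.log 3 ≤ 2 := (Real.log_le_sub_one_of_pos (by norm_num)).trans (by norm_num)
    -- `M (1 - τ²/2) ≤ 1 + log 3 + 20 log K ≤ 22 log K`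
    have h4 : M * (2 - τ ^ 2) ≤ 44 * Real.log K := by nlinarith
    have : 2 - τ ^ 2 ≤ 44 * Real.log K / M := by
      rw [le_div_iff₀ hM0]; linarith
    linarith
  have hτ1 : 1 ≤ τ := by
    have h44 : 44 * Real.log K / M ≤ 1 / 2 := by
      rw [div_le_div_iff₀ hM0 (by norm_num)]; linarith
    nlinarith
  exact ⟨hearly, hlate, hτ1, hτ32, hcτeq⟩

end CriticalTime

section PhaseTwo

/-! ## After the critical time: `b ≳ ε`, (c-large), (cgrow-2) -/

variable {K M ε κ τ δ : ℝ} {X : ℝ → Fin 5 → ℝ}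

/-- `b ≥ ε/8` on `[τ,2]` ("`b(t) ≳ ε` for `t ∈ [t_c,2]`", from (bogo-2) at `t_c` and
`∂ₜb ≥ -9MK²⁰ε³e^{18M} ≥ -ε/16`; kicked datum). [cite: Tao2016AveragedNS, §5.5 proof] -/
theorem b_lower_after (hX : ∀ t, HasDerivAt X (delayCircuitWith K M ε (X t)) t) (h0 : IsKickedWith K M ε κ X)
    (hε : 0 < ε) (hε1 : ε ≤ 1) (hM0 : 0 < M) (hMK : M ≤ K ^ 10) (hK : 16 ≤ K) (hεK : ε ^ 2 ≤ 1 / (6 * K ^ 20))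
    (hεexp : ε ^ 2 ≤ exp (-(18 * M)) / (144 * M * K ^ 20))
    (hτ1 : 1 ≤ τ) (hτ2 : τ ≤ 2)
    (hcτ : ∀ t, 0 ≤ t → t ≤ τ → X t 2 ≤ ε ^ 2 / K ^ 10)
    {t : ℝ} (ht : t ∈ Icc τ 2) : ε / 8 ≤ X t 1 := by
  have hK0 : 0 < K := by linarith
  have hK1 : 1 ≤ K := by linarith
  set k : ℝ := M with hk
  have hk0 : 0 < k := hM0
  -- `b(τ) ≥ ε/2`
  have hbτ : ε / 2 ≤ X τ 1 := by
    have hb := b_linear hX h0 hε hε1 hM0 hMK hK1 hτ2 hεK hcτ (t := τ) ⟨by linarith, le_rfl⟩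
    have h1 := (abs_le.1 hb).1
    have hK20 : 34 / K ^ 20 ≤ 1 / 2 := by
      rw [div_le_div_iff₀ (by positivity) (by norm_num)]
      have : (2 : ℝ) ^ 20 ≤ K ^ 20 := pow_le_pow_left₀ (by norm_num) (by linarith) 20
      nlinarith
    have h2 : 17 * ε / K ^ 20 * τ ≤ 34 / K ^ 20 * ε := by
      have : 17 * ε / K ^ 20 * τ ≤ 17 * ε / K ^ 20 * 2 :=
        mul_le_mul_of_nonneg_left hτ2 (by positivity)
      have h2e : 17 * ε / K ^ 20 * 2 = 34 / K ^ 20 * ε := by ring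
      linarith
    have h3 : 34 / K ^ 20 * ε ≤ 1 / 2 * ε := mul_le_mul_of_nonneg_right hK20 hε.le
    nlinarith
  -- `∂ₜb ≥ -ε/16` on `[τ,2]`
  have hmono := monotoneOn_sub_of_le_deriv (φ := fun _ => -(ε / 16))
    (Φ := fun s => -(ε / 16) * s) (convex_Icc τ 2) (fun s _ => hasDerivAt_b hX s)
    (fun s _ => ((hasDerivAt_id s).const_mul (-(ε / 16))).congr_deriv (by simp))
    (fun s hs => by
      have hs02 : s ∈ Icc (0 : ℝ) 2 := ⟨by linarith [hs.1], hs.2⟩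
      have hc0 : 0 ≤ X s 2 := c_nonneg hX h0 hs02.1
      have hcc := c_crude hX h0 hε hε1 hM0.le hs02
      -- the tolerance: `κe^{M} + 2ε² ≤ K¹⁰ε² + 2ε² ≤ 3K¹⁰ε²`
      have hK10 : (1 : ℝ) ≤ K ^ 10 := one_le_pow₀ hK1
      have hlam : κ * exp M + 2 * ε ^ 2 ≤ 3 * K ^ 10 * ε ^ 2 := by
        have := h0.le_tol; nlinarith [sq_nonneg ε]
      have hc9 : X s 2 ≤ 3 * K ^ 10 * ε ^ 2 * exp (9 * k) := by
        calc X s 2 ≤ (κ * exp M + 2 * ε ^ 2) * exp ((5 * s - 1) * M) := hcc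
          _ ≤ (3 * K ^ 10 * ε ^ 2) * exp (9 * k) :=
              mul_le_mul hlam (exp_le_exp.2 (by simp only [hk]; nlinarith [hs.2])) (exp_pos _).le
                (by positivity)
      have hc2 : X s 2 ^ 2 ≤ (3 * K ^ 10 * ε ^ 2 * exp (9 * k)) ^ 2 := pow_le_pow_left₀ hc0 hc9 2
      -- `ν c² ≤ 9 k K²⁰ ε³ e^{18k} ≤ ε/16`
      have hνc : ε⁻¹ * M * X s 2 ^ 2 ≤ ε / 16 := by
        have hε2 : ε ^ 2 * exp (18 * k) ≤ 1 / (144 * k * K ^ 20) := by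
          have := hεexp
          calc ε ^ 2 * exp (18 * k) ≤ exp (-(18 * k)) / (144 * k * K ^ 20) * exp (18 * k) :=
                mul_le_mul_of_nonneg_right this (exp_pos _).le
            _ = 1 / (144 * k * K ^ 20) := by
                rw [div_mul_eq_mul_div, mul_comm (exp _) (exp _), ← exp_add, add_neg_cancel,
                  exp_zero]
        calc ε⁻¹ * M * X s 2 ^ 2 ≤ ε⁻¹ * M * (3 * K ^ 10 * ε ^ 2 * exp (9 * k)) ^ 2 :=
              mul_le_mul_of_nonneg_left hc2 (by positivity)
          _ = 9 * k * K ^ 20 * ε * (ε ^ 2 * exp (18 * k)) := by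
              rw [show (18 : ℝ) * k = 9 * k + 9 * k by ring, exp_add]
              field_simp
              ring
          _ ≤ 9 * k * K ^ 20 * ε * (1 / (144 * k * K ^ 20)) :=
              mul_le_mul_of_nonneg_left hε2 (by positivity)
          _ = ε / 16 := by field_simp; ring
      have ha2 : 0 ≤ ε * X s 0 ^ 2 := by positivity
      linarith)
  have hτmem : τ ∈ Icc τ 2 := ⟨le_rfl, hτ2⟩
  have h := hmono hτmem ht ht.1
  simp only at h
  have : t - τ ≤ 1 := by linarith [ht.2]
  nlinarith

/-- Exponential growth after `t_c`: `c(t) ≥ K⁻¹⁰ε² exp(M(t-τ)/8)` on `[τ,2]` (from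
`∂ₜc ≥ νbc ≥ (M/8)c`). [cite: Tao2016AveragedNS, §5.5 (c-large)] -/
theorem c_growth (hX : ∀ t, HasDerivAt X (delayCircuitWith K M ε (X t)) t) (h0 : IsKickedWith K M ε κ X)
    (hε : 0 < ε) (hε1 : ε ≤ 1) (hM0 : 0 < M) (hMK : M ≤ K ^ 10) (hK : 16 ≤ K) (hεK : ε ^ 2 ≤ 1 / (6 * K ^ 20))
    (hεexp : ε ^ 2 ≤ exp (-(18 * M)) / (144 * M * K ^ 20))
    (hτ1 : 1 ≤ τ) (hτ2 : τ ≤ 2)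
    (hcτ : ∀ t, 0 ≤ t → t ≤ τ → X t 2 ≤ ε ^ 2 / K ^ 10) (hcτeq : X τ 2 = ε ^ 2 / K ^ 10)
    {t : ℝ} (ht : t ∈ Icc τ 2) :
    ε ^ 2 / K ^ 10 * exp (M * (t - τ) / 8) ≤ X t 2 := by
  have hK0 : 0 < K := by linarith
  set k : ℝ := M with hk
  have hk0 : 0 < k := hM0
  have hmono := monotoneOn_intFactor (s := Icc τ 2) (g := fun _ => k / 8)
    (G := fun s => k / 8 * s) (φ := fun _ => 0) (Φ := fun _ => 0) (convex_Icc τ 2)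
    (fun s _ => hasDerivAt_c hX s)
    (fun s _ => ((hasDerivAt_id s).const_mul (k / 8)).congr_deriv (by simp))
    (fun s _ => hasDerivAt_const s (0 : ℝ))
    (fun s hs => by
      have hc0 : 0 ≤ X s 2 := c_nonneg hX h0 (by linarith [hs.1])
      have hb : ε / 8 ≤ X s 1 := b_lower_after hX h0 hε hε1 hM0 hMK hK hεK hεexp hτ1 hτ2 hcτ hs
      have hνb : k / 8 ≤ ε⁻¹ * M * X s 1 := by
        calc k / 8 = ε⁻¹ * M * (ε / 8) := by simp only [hk]; field_simp
          _ ≤ ε⁻¹ * M * X s 1 := mul_le_mul_of_nonneg_left hb (by positivity)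
      have h1 : k / 8 * X s 2 ≤ ε⁻¹ * M * X s 1 * X s 2 :=
        mul_le_mul_of_nonneg_right hνb hc0
      have h2 : 0 ≤ ε ^ 2 * exp (-M) * X s 0 ^ 2 := by positivity
      have : 0 ≤ ε ^ 2 * exp (-M) * X s 0 ^ 2 + ε⁻¹ * M * X s 1 * X s 2
          - k / 8 * X s 2 := by linarith
      exact mul_nonneg this (exp_pos _).le)
  have hτmem : τ ∈ Icc τ 2 := ⟨le_rfl, hτ2⟩
  have h := hmono hτmem ht ht.1
  simp only [sub_zero, hcτeq] at h
  have hE : X t 2 = X t 2 * exp (-(k / 8 * t)) * exp (k / 8 * t) := by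
    rw [mul_assoc, ← exp_add, neg_add_cancel, exp_zero, mul_one]
  rw [hE]
  calc ε ^ 2 / K ^ 10 * exp (k * (t - τ) / 8)
      = ε ^ 2 / K ^ 10 * exp (-(k / 8 * τ)) * exp (k / 8 * t) := by
        rw [mul_assoc, ← exp_add]; congr 2; simp only [hk]; ring
    _ ≤ X t 2 * exp (-(k / 8 * t)) * exp (k / 8 * t) :=
        mul_le_mul_of_nonneg_right h (exp_pos _).le

/-- (c-large): `c ≥ K¹⁰⁰ε²` on `I = [τ + δ, 2]` for any onset delay `δ ≥ 0` with
`e^{Mδ/8} ≥ K¹¹⁰` (Tao, `M = K¹⁰`: `δ = K⁻⁹` via `e^{K/8} ≥ K¹¹⁰`; for the family `δ = 880 log K / M`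
exactly): "the rotor gate will be continuously and strongly activated from time `t_c + δ` onwards".
[cite: Tao2016AveragedNS, §5.5 (c-large)] -/
theorem c_large (hX : ∀ t, HasDerivAt X (delayCircuitWith K M ε (X t)) t) (h0 : IsKickedWith K M ε κ X)
    (hε : 0 < ε) (hε1 : ε ≤ 1) (hM0 : 0 < M) (hMK : M ≤ K ^ 10) (hK : 16 ≤ K) (hεK : ε ^ 2 ≤ 1 / (6 * K ^ 20))
    (hεexp : ε ^ 2 ≤ exp (-(18 * M)) / (144 * M * K ^ 20)) (hδ : 0 ≤ δ) (hon : K ^ 110 ≤ exp (M * δ / 8))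
    (hτ1 : 1 ≤ τ) (hτ2 : τ ≤ 2)
    (hcτ : ∀ t, 0 ≤ t → t ≤ τ → X t 2 ≤ ε ^ 2 / K ^ 10) (hcτeq : X τ 2 = ε ^ 2 / K ^ 10)
    {t : ℝ} (ht : t ∈ Icc (τ + δ) 2) : K ^ 100 * ε ^ 2 ≤ X t 2 := by
  have hK0 : 0 < K := by linarith
  have ht' : t ∈ Icc τ 2 := ⟨by linarith [ht.1], ht.2⟩
  have hg := c_growth hX h0 hε hε1 hM0 hMK hK hεK hεexp hτ1 hτ2 hcτ hcτeq ht'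
  have hexp : M * δ / 8 ≤ M * (t - τ) / 8 := by
    have h1 : δ ≤ t - τ := by linarith [ht.1]
    have h2 : M * δ ≤ M * (t - τ) := mul_le_mul_of_nonneg_left h1 hM0.le
    linarith
  calc K ^ 100 * ε ^ 2 = ε ^ 2 / K ^ 10 * K ^ 110 := by field_simp
    _ ≤ ε ^ 2 / K ^ 10 * exp (M * δ / 8) := mul_le_mul_of_nonneg_left hon (by positivity)
    _ ≤ ε ^ 2 / K ^ 10 * exp (M * (t - τ) / 8) :=
        mul_le_mul_of_nonneg_left (exp_le_exp.2 hexp) (by positivity)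
    _ ≤ X t 2 := hg

/-- (cgrow-2): on `I`, `0 ≤ ∂ₜc ≤ 6K¹⁰c`. [cite: Tao2016AveragedNS, §5.5 (cgrow-2)] -/
theorem c_deriv_bounds (hX : ∀ t, HasDerivAt X (delayCircuitWith K M ε (X t)) t) (h0 : IsKickedWith K M ε κ X)
    (hε : 0 < ε) (hε1 : ε ≤ 1) (hM0 : 0 < M) (hMK : M ≤ K ^ 10) (hK : 16 ≤ K) (hεK : ε ^ 2 ≤ 1 / (6 * K ^ 20))
    (hεexp : ε ^ 2 ≤ exp (-(18 * M)) / (144 * M * K ^ 20)) (hδ : 0 ≤ δ) (hon : K ^ 110 ≤ exp (M * δ / 8))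
    (hτ1 : 1 ≤ τ) (hτ2 : τ ≤ 2)
    (hcτ : ∀ t, 0 ≤ t → t ≤ τ → X t 2 ≤ ε ^ 2 / K ^ 10) (hcτeq : X τ 2 = ε ^ 2 / K ^ 10)
    {t : ℝ} (ht : t ∈ Icc (τ + δ) 2) :
    0 ≤ ε ^ 2 * exp (-M) * X t 0 ^ 2 + ε⁻¹ * M * X t 1 * X t 2 ∧
      ε ^ 2 * exp (-M) * X t 0 ^ 2 + ε⁻¹ * M * X t 1 * X t 2 ≤ 6 * K ^ 10 * X t 2 := by
  have hK0 : 0 < K := by linarith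
  have ht' : t ∈ Icc τ 2 := ⟨by linarith [ht.1], ht.2⟩
  have ht02 : t ∈ Icc (0 : ℝ) 2 := ⟨by linarith [ht'.1], ht.2⟩
  have hc0 : 0 ≤ X t 2 := c_nonneg hX h0 ht02.1
  have hcl : K ^ 100 * ε ^ 2 ≤ X t 2 := c_large hX h0 hε hε1 hM0 hMK hK hεK hεexp hδ hon hτ1 hτ2 hcτ hcτeq ht
  have hb : ε / 8 ≤ X t 1 := b_lower_after hX h0 hε hε1 hM0 hMK hK hεK hεexp hτ1 hτ2 hcτ ht'
  have hb5 : |X t 1| ≤ 5 * ε := (bc_small hX h0 hε hε1 hM0.le ht02).1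
  have ha : X t 0 ^ 2 ≤ 1 := traj_sq_le_one hX h0 t 0
  constructor
  · have h1 : 0 ≤ ε⁻¹ * M * X t 1 * X t 2 := by
      have : 0 ≤ X t 1 := by linarith [hε.le]
      have := hM0.le
      positivity
    have := hM0.le
    positivity
  · -- `μ a² ≤ ε² ≤ K¹⁰⁰ ε² ≤ c ≤ K¹⁰ c` and `ν b c ≤ 5 K¹⁰ c`
    have hek : exp (-M) ≤ 1 := by rw [exp_le_one_iff, neg_nonpos]; exact hM0.le
    have h1 : ε ^ 2 * exp (-M) * X t 0 ^ 2 ≤ K ^ 10 * X t 2 := by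
      calc ε ^ 2 * exp (-M) * X t 0 ^ 2 ≤ ε ^ 2 * 1 * 1 :=
            mul_le_mul (mul_le_mul_of_nonneg_left hek (by positivity)) ha (by positivity)
              (by positivity)
        _ ≤ K ^ 100 * ε ^ 2 := by
            have : (1 : ℝ) ≤ K ^ 100 := one_le_pow₀ (by linarith)
            nlinarith [pow_pos hε 2]
        _ ≤ X t 2 := hcl
        _ ≤ K ^ 10 * X t 2 := by
            have : (1 : ℝ) ≤ K ^ 10 := one_le_pow₀ (by linarith)
            nlinarith
    have h2 : ε⁻¹ * M * X t 1 * X t 2 ≤ 5 * K ^ 10 * X t 2 := by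
      have hb' : X t 1 ≤ 5 * ε := (le_abs_self _).trans hb5
      have h5 : ε⁻¹ * X t 1 ≤ 5 := by rw [inv_mul_le_iff₀ hε]; linarith
      have : ε⁻¹ * M * X t 1 * X t 2 = (ε⁻¹ * X t 1) * (M * X t 2) := by ring
      rw [this]
      have hkc : 0 ≤ M * X t 2 := mul_nonneg hM0.le hc0
      have hMc : M * X t 2 ≤ K ^ 10 * X t 2 := mul_le_mul_of_nonneg_right hMK hc0
      nlinarith
    linarith

/-! ## Equipartition: the corrector `V = a d ε²/c` and (douse) -/

/-- Size of the remainder in `∂ₜV` on `I`: `|R| ≤ 9K⁻⁹⁰` (uses `ε²/c ≤ K⁻¹⁰⁰`, `0 ≤ ∂ₜc ≤ 6K¹⁰c`,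
all modes `O(1)`). [cite: Tao2016AveragedNS, §5.5 (douse)] -/
theorem V_remainder_le (hX : ∀ t, HasDerivAt X (delayCircuitWith K M ε (X t)) t) (h0 : IsKickedWith K M ε κ X)
    (hε : 0 < ε) (hε1 : ε ≤ 1) (hM0 : 0 < M) (hMK : M ≤ K ^ 10) (hK : 16 ≤ K) (hεK : ε ^ 2 ≤ 1 / (6 * K ^ 20))
    (hεexp : ε ^ 2 ≤ exp (-(18 * M)) / (144 * M * K ^ 20)) (hδ : 0 ≤ δ) (hon : K ^ 110 ≤ exp (M * δ / 8))
    (hτ1 : 1 ≤ τ) (hτ2 : τ ≤ 2)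
    (hcτ : ∀ t, 0 ≤ t → t ≤ τ → X t 2 ≤ ε ^ 2 / K ^ 10) (hcτeq : X τ 2 = ε ^ 2 / K ^ 10)
    {t : ℝ} (ht : t ∈ Icc (τ + δ) 2) :
    |(-(ε * X t 0 * X t 1 * X t 3 + ε ^ 2 * exp (-M) * X t 0 * X t 2 * X t 3
            + K * X t 0 * X t 3 * X t 4) * (ε ^ 2 * (X t 2)⁻¹)
          - X t 0 * X t 3 * (ε ^ 2 * (X t 2)⁻¹) *
            ((ε ^ 2 * exp (-M) * X t 0 ^ 2 + ε⁻¹ * M * X t 1 * X t 2) * (X t 2)⁻¹))|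
      ≤ 9 / K ^ 90 := by
  have hK0 : 0 < K := by linarith
  have hK1 : 1 ≤ K := by linarith
  have hcl : K ^ 100 * ε ^ 2 ≤ X t 2 := c_large hX h0 hε hε1 hM0 hMK hK hεK hεexp hδ hon hτ1 hτ2 hcτ hcτeq ht
  have hcpos : 0 < X t 2 := lt_of_lt_of_le (by positivity) hcl
  obtain ⟨hc'0, hc'6⟩ := c_deriv_bounds hX h0 hε hε1 hM0 hMK hK hεK hεexp hδ hon hτ1 hτ2 hcτ hcτeq ht
  set q : ℝ := ε ^ 2 * (X t 2)⁻¹ with hq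
  have hq0 : 0 ≤ q := by positivity
  have hq1 : q ≤ 1 / K ^ 100 := by
    simp only [hq]
    rw [← div_eq_mul_inv, div_le_div_iff₀ hcpos (by positivity), one_mul]
    linarith
  set c' : ℝ := ε ^ 2 * exp (-M) * X t 0 ^ 2 + ε⁻¹ * M * X t 1 * X t 2 with hc'
  have hrat0 : 0 ≤ c' * (X t 2)⁻¹ := by positivity
  have hrat : c' * (X t 2)⁻¹ ≤ 6 * K ^ 10 := by
    rw [← div_eq_mul_inv, div_le_iff₀ hcpos]; exact hc'6
  have ha : |X t 0| ≤ 1 := traj_abs_le_one hX h0 t 0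
  have hb : |X t 1| ≤ 1 := traj_abs_le_one hX h0 t 1
  have hc : |X t 2| ≤ 1 := traj_abs_le_one hX h0 t 2
  have hd : |X t 3| ≤ 1 := traj_abs_le_one hX h0 t 3
  have he : |X t 4| ≤ 1 := traj_abs_le_one hX h0 t 4
  have hμ1 : ε ^ 2 * exp (-M) ≤ 1 := by
    have hek : exp (-M) ≤ 1 := by rw [exp_le_one_iff, neg_nonpos]; exact hM0.le
    calc ε ^ 2 * exp (-M) ≤ 1 ^ 2 * 1 :=
          mul_le_mul (pow_le_pow_left₀ hε.le hε1 2) hek (exp_pos _).le (by positivity)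
      _ = 1 := by ring
  -- term 1
  have hT1 : |(-(ε * X t 0 * X t 1 * X t 3 + ε ^ 2 * exp (-M) * X t 0 * X t 2 * X t 3
      + K * X t 0 * X t 3 * X t 4) * q)| ≤ (2 + K) * (1 / K ^ 100) := by
    rw [abs_mul, abs_neg, abs_of_nonneg hq0]
    have hin : |ε * X t 0 * X t 1 * X t 3 + ε ^ 2 * exp (-M) * X t 0 * X t 2 * X t 3
        + K * X t 0 * X t 3 * X t 4| ≤ 2 + K := by
      have e1 : |ε * X t 0 * X t 1 * X t 3| ≤ 1 := by
        rw [abs_mul, abs_mul, abs_mul, abs_of_pos hε]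
        calc ε * |X t 0| * |X t 1| * |X t 3| ≤ 1 * 1 * 1 * 1 := by
              gcongr
          _ = 1 := by ring
      have e2 : |ε ^ 2 * exp (-M) * X t 0 * X t 2 * X t 3| ≤ 1 := by
        rw [abs_mul, abs_mul, abs_mul, abs_of_nonneg (by positivity : 0 ≤ ε ^ 2 * exp (-M))]
        calc ε ^ 2 * exp (-M) * |X t 0| * |X t 2| * |X t 3| ≤ 1 * 1 * 1 * 1 := by
              gcongr
          _ = 1 := by ring
      have e3 : |K * X t 0 * X t 3 * X t 4| ≤ K := by
        rw [abs_mul, abs_mul, abs_mul, abs_of_pos hK0]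
        calc K * |X t 0| * |X t 3| * |X t 4| ≤ K * 1 * 1 * 1 := by gcongr
          _ = K := by ring
      calc _ ≤ |ε * X t 0 * X t 1 * X t 3 + ε ^ 2 * exp (-M) * X t 0 * X t 2 * X t 3|
            + |K * X t 0 * X t 3 * X t 4| := abs_add_le _ _
        _ ≤ |ε * X t 0 * X t 1 * X t 3| + |ε ^ 2 * exp (-M) * X t 0 * X t 2 * X t 3|
            + |K * X t 0 * X t 3 * X t 4| := by
            have := abs_add_le (ε * X t 0 * X t 1 * X t 3)
              (ε ^ 2 * exp (-M) * X t 0 * X t 2 * X t 3)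
            linarith
        _ ≤ 2 + K := by linarith
    exact mul_le_mul hin hq1 hq0 (by positivity)
  -- term 2
  have hT2 : |X t 0 * X t 3 * q * (c' * (X t 2)⁻¹)| ≤ 6 * K ^ 10 * (1 / K ^ 100) := by
    rw [abs_mul, abs_mul, abs_mul, abs_of_nonneg hq0, abs_of_nonneg hrat0]
    calc |X t 0| * |X t 3| * q * (c' * (X t 2)⁻¹) ≤ 1 * 1 * (1 / K ^ 100) * (6 * K ^ 10) := by
          gcongr
      _ = 6 * K ^ 10 * (1 / K ^ 100) := by ring
  have hsum : (2 + K) * (1 / K ^ 100) + 6 * K ^ 10 * (1 / K ^ 100) ≤ 9 / K ^ 90 := by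
    have h10 : 2 + K ≤ 3 * K ^ 10 := by
      have : K ≤ K ^ 10 := le_self_pow₀ hK1 (by norm_num)
      linarith
    rw [show 9 / K ^ 90 = 9 * K ^ 10 * (1 / K ^ 100) by field_simp]
    have : 0 ≤ 1 / K ^ 100 := by positivity
    nlinarith
  calc _ ≤ |(-(ε * X t 0 * X t 1 * X t 3 + ε ^ 2 * exp (-M) * X t 0 * X t 2 * X t 3
        + K * X t 0 * X t 3 * X t 4) * q)| + |X t 0 * X t 3 * q * (c' * (X t 2)⁻¹)| :=
        abs_sub _ _
    _ ≤ (2 + K) * (1 / K ^ 100) + 6 * K ^ 10 * (1 / K ^ 100) := add_le_add hT1 hT2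
    _ ≤ 9 / K ^ 90 := hsum

end PhaseTwo


section PhaseThree

/-! ## The claim (atc): `ã(t_c + 1/K) ≥ 1/10` -/

variable {K M ε κ τ δ : ℝ} {X : ℝ → Fin 5 → ℝ}

/-- **(atc)** with onset `σ = t_c + δ`: `ã(σ + 1/K) ≥ 1/10`. If not, on `J = [σ, σ + 1/K]` one has
`ã ≤ 1/10`, hence `a² + d² ≥ 0.98`, while `Ψ = V + 2ã/K` has `∂ₜΨ = a² + d² + O(K⁻⁹⁰)` and total
variation `≤ 2K⁻¹⁰⁰ + 0.2/K` over `J` — a contradiction. [cite: Tao2016AveragedNS, §5.5 (atc)] -/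
theorem e_tenth (hX : ∀ t, HasDerivAt X (delayCircuitWith K M ε (X t)) t) (h0 : IsKickedWith K M ε κ X)
    (hε : 0 < ε) (hε1 : ε ≤ 1) (hM0 : 0 < M) (hMK : M ≤ K ^ 10) (hK : 16 ≤ K) (hεK : ε ^ 2 ≤ 1 / (6 * K ^ 20))
    (hεexp : ε ^ 2 ≤ exp (-(18 * M)) / (144 * M * K ^ 20)) (hδ : 0 ≤ δ) (hon : K ^ 110 ≤ exp (M * δ / 8))
    (hτ1 : 1 ≤ τ) (hfit : τ + δ + (sqrt K)⁻¹ ≤ 2)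
    (hcτ : ∀ t, 0 ≤ t → t ≤ τ → X t 2 ≤ ε ^ 2 / K ^ 10) (hcτeq : X τ 2 = ε ^ 2 / K ^ 10) :
    1 / 10 ≤ X (τ + δ + K⁻¹) 4 := by
  have hK0 : 0 < K := by linarith
  have hK1 : 1 ≤ K := by linarith
  have hsK : K⁻¹ ≤ (sqrt K)⁻¹ := by
    rw [inv_le_inv₀ hK0 (by positivity)]
    calc sqrt K ≤ sqrt K * sqrt K :=
          le_mul_of_one_le_right (by positivity) (by linarith [(invSqrt_facts hK).2.2.2.1])
      _ = K := mul_self_sqrt hK0.le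
  have hu0' : 0 < K⁻¹ := inv_pos.2 hK0
  have hτ2 : τ ≤ 2 := by linarith
  have ht12' : τ + δ + K⁻¹ ≤ 2 := by linarith
  set t₀ : ℝ := τ + δ with ht₀
  set t₁ : ℝ := τ + δ + K⁻¹ with ht₁
  have ht₀0 : 0 ≤ t₀ := by simp only [ht₀]; linarith
  have hKinv : K⁻¹ ≤ 1 / 16 := by rw [inv_le_comm₀ hK0 (by norm_num)]; linarith
  have h01 : t₀ ≤ t₁ := by simp only [ht₀, ht₁]; linarith
  have ht12 : t₁ ≤ 2 := by simp only [ht₁]; linarith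
  have hJI : ∀ s ∈ Icc t₀ t₁, s ∈ Icc (τ + δ) 2 := fun s hs => ⟨hs.1, hs.2.trans ht12⟩
  -- numeric facts
  have hK20 : (2 : ℝ) ^ 20 ≤ K ^ 20 := pow_le_pow_left₀ (by norm_num) (by linarith) 20
  have hK90 : (2 : ℝ) ^ 90 ≤ K ^ 90 := pow_le_pow_left₀ (by norm_num) (by linarith) 90
  have hε2 : (5 * ε) ^ 2 ≤ 1 / 1000 := by
    have h6 : 1 / (6 * K ^ 20) ≤ 1 / 25000 := by
      apply one_div_le_one_div_of_le (by norm_num); linarith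
    have : (5 * ε) ^ 2 = 25 * ε ^ 2 := by ring
    rw [this]; linarith
  have hK90' : 9 / K ^ 90 ≤ 1 / 1000 := by
    rw [div_le_div_iff₀ (by positivity) (by norm_num)]; linarith
  by_contra hlt'
  have hlt := not_le.1 hlt'
  have hmonoE := delayCircuitWith_output_monotone hK0.le hX
  -- `Ψ = V + (2/K) ã` has derivative `≥ 0.97` on `J`
  have hmono := monotoneOn_sub_of_le_deriv (φ := fun _ => (97 : ℝ) / 100)
    (Φ := fun s => 97 / 100 * s) (convex_Icc t₀ t₁)
    (f := fun s => X s 0 * X s 3 * (ε ^ 2 * (X s 2)⁻¹) + 2 / K * X s 4)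
    (fun s hs => by
      have hsI := hJI s hs
      have hcl : K ^ 100 * ε ^ 2 ≤ X s 2 :=
        c_large hX h0 hε hε1 hM0 hMK hK hεK hεexp hδ hon hτ1 hτ2 hcτ hcτeq hsI
      have hcne : X s 2 ≠ 0 := (lt_of_lt_of_le (by positivity) hcl).ne'
      exact (hasDerivAt_V hX hε.ne' hcne).add ((hasDerivAt_e hX s).const_mul (2 / K)))
    (fun s _ => ((hasDerivAt_id s).const_mul ((97 : ℝ) / 100)).congr_deriv (by simp))
    (fun s hs => by
      have hsI := hJI s hs
      have hs02 : s ∈ Icc (0 : ℝ) 2 := ⟨by linarith [hs.1, ht₀0], hsI.2⟩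
      have hR := V_remainder_le hX h0 hε hε1 hM0 hMK hK hεK hεexp hδ hon hτ1 hτ2 hcτ hcτeq hsI
      have hRlo := (abs_le.1 hR).1
      have hsum := traj_sum_sq_eq_one hX h0 s
      obtain ⟨hb5, hc5⟩ := bc_small hX h0 hε hε1 hM0.le hs02
      have hb2 : X s 1 ^ 2 ≤ (5 * ε) ^ 2 := by
        rw [← sq_abs]; exact pow_le_pow_left₀ (abs_nonneg _) hb5 2
      have hc2 : X s 2 ^ 2 ≤ (5 * ε) ^ 2 := by
        rw [← sq_abs]; exact pow_le_pow_left₀ (abs_nonneg _) hc5 2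
      have hes : X s 4 ≤ 1 / 10 := (hmonoE hs.2).trans hlt.le
      have hes0 : 0 ≤ X s 4 := e_nonneg hX h0 hK0.le hs02.1
      have he2 : X s 4 ^ 2 ≤ 1 / 100 := by
        have := pow_le_pow_left₀ hes0 hes 2; norm_num at this; exact this
      have hKd : 2 / K * (K * X s 3 ^ 2) = 2 * X s 3 ^ 2 := by field_simp
      rw [hKd]
      linarith)
  have hmem0 : t₀ ∈ Icc t₀ t₁ := ⟨le_rfl, h01⟩
  have hmem1 : t₁ ∈ Icc t₀ t₁ := ⟨h01, le_rfl⟩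
  have h := hmono hmem0 hmem1 h01
  simp only at h
  -- sizes of `V` at the endpoints and of `ã`
  have hV : ∀ s ∈ Icc t₀ t₁, |X s 0 * X s 3 * (ε ^ 2 * (X s 2)⁻¹)| ≤ 1 / K ^ 100 := by
    intro s hs
    have hsI := hJI s hs
    have hcl : K ^ 100 * ε ^ 2 ≤ X s 2 :=
      c_large hX h0 hε hε1 hM0 hMK hK hεK hεexp hδ hon hτ1 hτ2 hcτ hcτeq hsI
    have hcpos : 0 < X s 2 := lt_of_lt_of_le (by positivity) hcl
    have hq0 : 0 ≤ ε ^ 2 * (X s 2)⁻¹ := by positivity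
    have hq : ε ^ 2 * (X s 2)⁻¹ ≤ 1 / K ^ 100 := by
      rw [← div_eq_mul_inv, div_le_div_iff₀ hcpos (by positivity), one_mul]; linarith
    rw [abs_mul, abs_mul, abs_of_nonneg hq0]
    calc |X s 0| * |X s 3| * (ε ^ 2 * (X s 2)⁻¹) ≤ 1 * 1 * (1 / K ^ 100) :=
          mul_le_mul (mul_le_mul (traj_abs_le_one hX h0 s 0) (traj_abs_le_one hX h0 s 3) (abs_nonneg _)
            zero_le_one) hq hq0 (by norm_num)
      _ = 1 / K ^ 100 := by ring
  have hV0 := (abs_le.1 (hV t₀ hmem0)).1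
  have hV1 := (abs_le.1 (hV t₁ hmem1)).2
  have he0 : 0 ≤ X t₀ 4 := e_nonneg hX h0 hK0.le ht₀0
  have hlen : t₁ - t₀ = K⁻¹ := by simp only [ht₀, ht₁]; ring
  -- numeric contradiction, in the variable `u = 1/K`
  set u : ℝ := K⁻¹ with hu
  have hu0 : 0 < u := by positivity
  have hK8 : (2 : ℝ) ^ 8 ≤ K ^ 8 := pow_le_pow_left₀ (by norm_num) (by linarith) 8
  have hK99 : (2 : ℝ) ^ 8 ≤ K ^ 99 := hK8.trans (pow_le_pow_right₀ hK1 (by norm_num))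
  have hi99 : (K ^ 99)⁻¹ ≤ 1 / 256 := by
    rw [one_div, inv_le_inv₀ (by positivity) (by norm_num)]; linarith
  have h100 : 1 / K ^ 100 ≤ u * (1 / 256) := by
    rw [show 1 / K ^ 100 = u * (K ^ 99)⁻¹ by
      simp only [hu]; rw [← mul_inv, ← pow_succ', one_div]]
    exact mul_le_mul_of_nonneg_left hi99 hu0.le
  have hKu : 2 / K * X t₁ 4 - 2 / K * X t₀ 4 ≤ 2 * u * (1 / 10) := by
    have : 2 / K * X t₁ 4 - 2 / K * X t₀ 4 = 2 * u * (X t₁ 4 - X t₀ 4) := by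
      simp only [hu]; ring
    rw [this]
    exact mul_le_mul_of_nonneg_left (by linarith) (by positivity)
  have hfin : 97 / 100 * (t₁ - t₀) ≤ 2 * (u * (1 / 256)) + 2 * u * (1 / 10) := by linarith
  rw [hlen] at hfin
  linarith

/-! ## Equipartition energy `E_*` and its decay (toke) -/

/-- Dissipation inequality for `E_*` on `[t', 2]`, `t' = t_c + 1/K`:
`∂ₜE_* + Kã(t')E_* ≤ 7K⁻⁸⁹`. [cite: Tao2016AveragedNS, §5.5 (proof of (beable))] -/
theorem Es_dissipation (hX : ∀ t, HasDerivAt X (delayCircuitWith K M ε (X t)) t) (h0 : IsKickedWith K M ε κ X)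
    (hε : 0 < ε) (hε1 : ε ≤ 1) (hM0 : 0 < M) (hMK : M ≤ K ^ 10) (hK : 16 ≤ K) (hεK : ε ^ 2 ≤ 1 / (6 * K ^ 20))
    (hε100 : ε ≤ 1 / K ^ 100)
    (hεexp : ε ^ 2 ≤ exp (-(18 * M)) / (144 * M * K ^ 20)) (hδ : 0 ≤ δ) (hon : K ^ 110 ≤ exp (M * δ / 8))
    (hτ1 : 1 ≤ τ) (hfit : τ + δ + (sqrt K)⁻¹ ≤ 2)
    (hcτ : ∀ t, 0 ≤ t → t ≤ τ → X t 2 ≤ ε ^ 2 / K ^ 10) (hcτeq : X τ 2 = ε ^ 2 / K ^ 10)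
    {s : ℝ} (hs : s ∈ Icc (τ + δ + K⁻¹) 2) :
    (-(K / 2) * X s 4 * (X s 0 ^ 2 + X s 3 ^ 2)
        - K / 2 * ((-(ε * X s 0 * X s 1 * X s 3 + ε ^ 2 * exp (-M) * X s 0 * X s 2 * X s 3
            + K * X s 0 * X s 3 * X s 4) * (ε ^ 2 * (X s 2)⁻¹)
          - X s 0 * X s 3 * (ε ^ 2 * (X s 2)⁻¹) *
            ((ε ^ 2 * exp (-M) * X s 0 ^ 2 + ε⁻¹ * M * X s 1 * X s 2) * (X s 2)⁻¹)))
          * X s 4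
        - K ^ 2 / 2 * (X s 0 * X s 3 * (ε ^ 2 * (X s 2)⁻¹)) * X s 3 ^ 2)
      + K * X (τ + δ + K⁻¹) 4 * ((1 - X s 4 * X s 4) / 2
        - K / 2 * (X s 0 * X s 3 * (ε ^ 2 * (X s 2)⁻¹) * X s 4)) ≤ 7 / K ^ 89 := by
  have hK0 : 0 < K := by linarith
  have hK1 : 1 ≤ K := by linarith
  have hτ2 : τ ≤ 2 := by linarith [inv_nonneg.2 (sqrt_nonneg K)]
  have hu0' : 0 < K⁻¹ := inv_pos.2 hK0
  have hsI : s ∈ Icc (τ + δ) 2 := ⟨by linarith [hs.1], hs.2⟩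
  have hs02 : s ∈ Icc (0 : ℝ) 2 := ⟨by linarith [hs.1], hs.2⟩
  have hcl : K ^ 100 * ε ^ 2 ≤ X s 2 := c_large hX h0 hε hε1 hM0 hMK hK hεK hεexp hδ hon hτ1 hτ2 hcτ hcτeq hsI
  have hcpos : 0 < X s 2 := lt_of_lt_of_le (by positivity) hcl
  have hq0 : 0 ≤ ε ^ 2 * (X s 2)⁻¹ := by positivity
  have hq1 : ε ^ 2 * (X s 2)⁻¹ ≤ 1 / K ^ 100 := by
    rw [← div_eq_mul_inv, div_le_div_iff₀ hcpos (by positivity), one_mul]; linarith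
  obtain ⟨hb5, hc5⟩ := bc_small hX h0 hε hε1 hM0.le hs02
  have hb2 : X s 1 ^ 2 ≤ (5 * ε) ^ 2 := by
    rw [← sq_abs]; exact pow_le_pow_left₀ (abs_nonneg _) hb5 2
  have hc2 : X s 2 ^ 2 ≤ (5 * ε) ^ 2 := by
    rw [← sq_abs]; exact pow_le_pow_left₀ (abs_nonneg _) hc5 2
  have hmonoE := delayCircuitWith_output_monotone hK0.le hX
  exact Es_alg hK (traj_sum_sq_eq_one hX h0 s) hq0 hq1
    (V_remainder_le hX h0 hε hε1 hM0 hMK hK hεK hεexp hδ hon hτ1 hτ2 hcτ hcτeq hsI)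
    (traj_abs_le_one hX h0 s 0) (traj_abs_le_one hX h0 s 3) (traj_abs_le_one hX h0 s 4)
    (e_nonneg hX h0 hK0.le (by linarith))
    ((le_abs_self _).trans (traj_abs_le_one hX h0 _ 4)) (hmonoE hs.1) hb2 hc2 hε hε1 hε100

end PhaseThree


section Decay

variable {K M ε κ τ δ : ℝ} {X : ℝ → Fin 5 → ℝ}

/-- On `I = [t_c + δ, 2]`: `|½K·V·ã| ≤ ½K⁻⁹⁹` (`V = adε²/c`, `ε²/c ≤ K⁻¹⁰⁰`).
[cite: Tao2016AveragedNS, §5.5 (proof of (beable))] -/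
theorem KVe_small (hX : ∀ t, HasDerivAt X (delayCircuitWith K M ε (X t)) t) (h0 : IsKickedWith K M ε κ X)
    (hε : 0 < ε) (hε1 : ε ≤ 1) (hM0 : 0 < M) (hMK : M ≤ K ^ 10) (hK : 16 ≤ K) (hεK : ε ^ 2 ≤ 1 / (6 * K ^ 20))
    (hεexp : ε ^ 2 ≤ exp (-(18 * M)) / (144 * M * K ^ 20)) (hδ : 0 ≤ δ) (hon : K ^ 110 ≤ exp (M * δ / 8))
    (hτ1 : 1 ≤ τ) (hτ2 : τ ≤ 2)
    (hcτ : ∀ t, 0 ≤ t → t ≤ τ → X t 2 ≤ ε ^ 2 / K ^ 10) (hcτeq : X τ 2 = ε ^ 2 / K ^ 10)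
    {s : ℝ} (hs : s ∈ Icc (τ + δ) 2) :
    |K / 2 * (X s 0 * X s 3 * (ε ^ 2 * (X s 2)⁻¹) * X s 4)| ≤ 1 / 2 / K ^ 99 := by
  have hK0 : 0 < K := by linarith
  have hcl : K ^ 100 * ε ^ 2 ≤ X s 2 :=
    c_large hX h0 hε hε1 hM0 hMK hK hεK hεexp hδ hon hτ1 hτ2 hcτ hcτeq hs
  have hcpos : 0 < X s 2 := lt_of_lt_of_le (by positivity) hcl
  have hq0 : 0 ≤ ε ^ 2 * (X s 2)⁻¹ := by positivity
  have hq : ε ^ 2 * (X s 2)⁻¹ ≤ 1 / K ^ 100 := by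
    rw [← div_eq_mul_inv, div_le_div_iff₀ hcpos (by positivity), one_mul]; linarith
  rw [abs_mul, abs_of_pos (by positivity : 0 < K / 2), abs_mul, abs_mul, abs_mul,
    abs_of_nonneg hq0]
  calc K / 2 * (|X s 0| * |X s 3| * (ε ^ 2 * (X s 2)⁻¹) * |X s 4|)
      ≤ K / 2 * (1 * 1 * (1 / K ^ 100) * 1) := by
        refine mul_le_mul_of_nonneg_left ?_ (by positivity)
        exact mul_le_mul (mul_le_mul (mul_le_mul (traj_abs_le_one hX h0 s 0)
          (traj_abs_le_one hX h0 s 3) (abs_nonneg _) zero_le_one) hq hq0 (by norm_num))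
          (traj_abs_le_one hX h0 s 4) (abs_nonneg _) (by positivity)
    _ = 1 / 2 / K ^ 99 := by field_simp

/-- **(toke)**: on `[σ + 1/√K, 2]` (`σ = t_c + δ`),
`E_*(t) ≤ e^{-Kã(t')(t-t')} + 7K⁻⁸⁹/(Kã(t')) ≤ e^{(1-√K)/10} + 70K⁻⁹⁰` (Grönwall from
`t' = σ + 1/K`, `ã(t') ≥ 1/10`). [cite: Tao2016AveragedNS, §5.5 (toke)] -/
theorem Es_decay (hX : ∀ t, HasDerivAt X (delayCircuitWith K M ε (X t)) t) (h0 : IsKickedWith K M ε κ X)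
    (hε : 0 < ε) (hε1 : ε ≤ 1) (hM0 : 0 < M) (hMK : M ≤ K ^ 10) (hK : 16 ≤ K) (hεK : ε ^ 2 ≤ 1 / (6 * K ^ 20))
    (hε100 : ε ≤ 1 / K ^ 100)
    (hεexp : ε ^ 2 ≤ exp (-(18 * M)) / (144 * M * K ^ 20)) (hδ : 0 ≤ δ) (hon : K ^ 110 ≤ exp (M * δ / 8))
    (hτ1 : 1 ≤ τ) (hfit : τ + δ + (sqrt K)⁻¹ ≤ 2)
    (hcτ : ∀ t, 0 ≤ t → t ≤ τ → X t 2 ≤ ε ^ 2 / K ^ 10) (hcτeq : X τ 2 = ε ^ 2 / K ^ 10)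
    {t : ℝ} (ht : t ∈ Icc (τ + δ + 1 / sqrt K) 2) :
    (1 - X t 4 * X t 4) / 2 - K / 2 * (X t 0 * X t 3 * (ε ^ 2 * (X t 2)⁻¹) * X t 4)
      ≤ exp ((1 - sqrt K) / 10) + 70 / K ^ 90 := by
  have hK0 : 0 < K := by linarith
  have hK1 : 1 ≤ K := by linarith
  obtain ⟨hs0, hs4, hKs, h4, hKs2⟩ := invSqrt_facts hK
  have hτ2 : τ ≤ 2 := by linarith
  have hu0' : 0 < K⁻¹ := inv_pos.2 hK0
  have he₀ : 1 / 10 ≤ X (τ + δ + K⁻¹) 4 := e_tenth hX h0 hε hε1 hM0 hMK hK hεK hεexp hδ hon hτ1 hfit hcτ hcτeq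
  have he₀pos : 0 < X (τ + δ + K⁻¹) 4 := lt_of_lt_of_le (by norm_num) he₀
  have hKe : 0 < K * X (τ + δ + K⁻¹) 4 := mul_pos hK0 he₀pos
  have hKinv : K⁻¹ ≤ (sqrt K)⁻¹ := by
    rw [inv_le_inv₀ hK0 (by positivity)]
    calc sqrt K ≤ sqrt K * sqrt K := le_mul_of_one_le_right (by positivity) (by linarith)
      _ = K := mul_self_sqrt hK0.le
  have ht't : τ + δ + K⁻¹ ≤ t := by rw [one_div] at ht; linarith [ht.1]
  have hI : ∀ s ∈ Icc (τ + δ + K⁻¹) 2, s ∈ Icc (τ + δ) 2 := fun s hs =>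
    ⟨by linarith [hs.1], hs.2⟩
  have hC0 : 0 ≤ 7 / K ^ 89 / (K * X (τ + δ + K⁻¹) 4) := by positivity
  -- Grönwall in integrating-factor form
  have hanti := antitoneOn_intFactor (s := Icc (τ + δ + K⁻¹) 2)
    (f := fun s => (1 - X s 4 * X s 4) / 2 - K / 2 * (X s 0 * X s 3 * (ε ^ 2 * (X s 2)⁻¹) * X s 4))
    (g := fun _ => -(K * X (τ + δ + K⁻¹) 4)) (G := fun s => -(K * X (τ + δ + K⁻¹) 4 * s))
    (φ := fun s => 7 / K ^ 89 * exp (K * X (τ + δ + K⁻¹) 4 * s))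
    (Φ := fun s => 7 / K ^ 89 / (K * X (τ + δ + K⁻¹) 4) * exp (K * X (τ + δ + K⁻¹) 4 * s))
    (convex_Icc _ 2)
    (fun s hs => by
      have hsI := hI s hs
      have hcl : K ^ 100 * ε ^ 2 ≤ X s 2 :=
        c_large hX h0 hε hε1 hM0 hMK hK hεK hεexp hδ hon hτ1 hτ2 hcτ hcτeq hsI
      have hcne : X s 2 ≠ 0 := (lt_of_lt_of_le (by positivity) hcl).ne'
      exact hasDerivAt_Es hX hε.ne' hcne)
    (fun s _ => ((hasDerivAt_id s).const_mul (K * X (τ + δ + K⁻¹) 4)).neg.congr_deriv (by simp))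
    (fun s _ => by
      have hne : K * X (τ + δ + K⁻¹) 4 ≠ 0 := hKe.ne'
      have := (((hasDerivAt_id s).const_mul (K * X (τ + δ + K⁻¹) 4)).exp).const_mul
        (7 / K ^ 89 / (K * X (τ + δ + K⁻¹) 4))
      refine this.congr_deriv ?_
      simp only [mul_one, id_eq]
      generalize X (τ + δ + K⁻¹) 4 = e₀ at hne ⊢
      have hne' : e₀ ≠ 0 := right_ne_zero_of_mul hne
      field_simp)
    (fun s hs => by
      have hdis := Es_dissipation hX h0 hε hε1 hM0 hMK hK hεK hε100 hεexp hδ hon hτ1 hfit hcτ hcτeq hs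
      have hE : exp (-(-(K * X (τ + δ + K⁻¹) 4 * s))) = exp (K * X (τ + δ + K⁻¹) 4 * s) := by
        rw [neg_neg]
      rw [hE]
      have h2 := mul_le_mul_of_nonneg_right hdis (exp_pos (K * X (τ + δ + K⁻¹) 4 * s)).le
      linarith)
  have ht'mem : τ + δ + K⁻¹ ∈ Icc (τ + δ + K⁻¹) 2 :=
    ⟨le_rfl, by linarith⟩
  have htmem : t ∈ Icc (τ + δ + K⁻¹) 2 := ⟨ht't, ht.2⟩
  have hA := hanti ht'mem htmem ht't
  simp only [neg_neg] at hA
  have hsplit : exp (K * X (τ + δ + K⁻¹) 4 * (τ + δ + K⁻¹))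
      = exp (K * X (τ + δ + K⁻¹) 4 * t) * exp (K * X (τ + δ + K⁻¹) 4 * ((τ + δ + K⁻¹) - t)) := by
    rw [← exp_add]; congr 1; ring
  rw [hsplit] at hA
  -- `E_*(t') ≤ 1`
  have hEs1 : (1 - X (τ + δ + K⁻¹) 4 * X (τ + δ + K⁻¹) 4) / 2
      - K / 2 * (X (τ + δ + K⁻¹) 0 * X (τ + δ + K⁻¹) 3 * (ε ^ 2 * (X (τ + δ + K⁻¹) 2)⁻¹) * X (τ + δ + K⁻¹) 4)
      ≤ 1 := by
    have h1 : (1 - X (τ + δ + K⁻¹) 4 * X (τ + δ + K⁻¹) 4) / 2 ≤ 1 / 2 := by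
      nlinarith [mul_self_nonneg (X (τ + δ + K⁻¹) 4)]
    have h2 := (abs_le.1 (KVe_small hX h0 hε hε1 hM0 hMK hK hεK hεexp hδ hon hτ1 hτ2 hcτ hcτeq
      (hI _ ht'mem))).1
    have h3 : 1 / 2 / K ^ 99 ≤ 1 / 2 := by
      rw [div_le_iff₀ (by positivity)]
      have : (1 : ℝ) ≤ K ^ 99 := one_le_pow₀ hK1
      linarith
    linarith
  have hρ0 : 0 < exp (K * X (τ + δ + K⁻¹) 4 * ((τ + δ + K⁻¹) - t)) := exp_pos _
  have hEst := decay_alg (exp_pos _) hρ0 hC0 hEs1 hA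
  -- `ρ ≤ exp((1 - √K)/10)`
  have hρle : exp (K * X (τ + δ + K⁻¹) 4 * ((τ + δ + K⁻¹) - t)) ≤ exp ((1 - sqrt K) / 10) := by
    rw [exp_le_exp]
    have h1 : K * X (τ + δ + K⁻¹) 4 * ((τ + δ + K⁻¹) - t) ≤ K * (1 / 10) * ((τ + δ + K⁻¹) - t) := by
      have hn : (τ + δ + K⁻¹) - t ≤ 0 := by linarith
      have := mul_le_mul_of_nonpos_right (mul_le_mul_of_nonneg_left he₀ hK0.le) hn
      linarith
    have h2 : K * (1 / 10) * ((τ + δ + K⁻¹) - t) ≤ K * (1 / 10) * (K⁻¹ - (sqrt K)⁻¹) := by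
      refine mul_le_mul_of_nonneg_left ?_ (by positivity)
      rw [one_div] at ht; linarith [ht.1]
    have h3 : K * (1 / 10) * (K⁻¹ - (sqrt K)⁻¹) = (1 - sqrt K) / 10 := by
      have : K * (sqrt K)⁻¹ = sqrt K := hKs
      have hKK : K * K⁻¹ = 1 := mul_inv_cancel₀ hK0.ne'
      calc K * (1 / 10) * (K⁻¹ - (sqrt K)⁻¹) = (K * K⁻¹ - K * (sqrt K)⁻¹) / 10 := by ring
        _ = (1 - sqrt K) / 10 := by rw [this, hKK]
    linarith
  have hCle : 7 / K ^ 89 / (K * X (τ + δ + K⁻¹) 4) ≤ 70 / K ^ 90 := by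
    rw [div_le_div_iff₀ hKe (by positivity)]
    calc 7 / K ^ 89 * K ^ 90 = 7 * K := by field_simp
      _ = 70 * (K * (1 / 10)) := by ring
      _ ≤ 70 * (K * X (τ + δ + K⁻¹) 4) := by
          have := mul_le_mul_of_nonneg_left he₀ hK0.le
          linarith
  linarith

/-- **(toke) ⇒ (beable), core estimate**: on `[σ + 1/√K, 2]`, `a² + d² ≤ 142K⁻²⁰`
(`a² + d² = 2E_* + KVã - b² - c²`). [cite: Tao2016AveragedNS, §5.5 (beable)] -/
theorem ad_small_late (hX : ∀ t, HasDerivAt X (delayCircuitWith K M ε (X t)) t) (h0 : IsKickedWith K M ε κ X)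
    (hε : 0 < ε) (hε1 : ε ≤ 1) (hM0 : 0 < M) (hMK : M ≤ K ^ 10) (hK : 16 ≤ K) (hεK : ε ^ 2 ≤ 1 / (6 * K ^ 20))
    (hε100 : ε ≤ 1 / K ^ 100)
    (hεexp : ε ^ 2 ≤ exp (-(18 * M)) / (144 * M * K ^ 20)) (hδ : 0 ≤ δ) (hon : K ^ 110 ≤ exp (M * δ / 8))
    (hN4 : 2 * exp ((1 - sqrt K) / 10) ≤ 1 / K ^ 20)
    (hτ1 : 1 ≤ τ) (hfit : τ + δ + (sqrt K)⁻¹ ≤ 2)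
    (hcτ : ∀ t, 0 ≤ t → t ≤ τ → X t 2 ≤ ε ^ 2 / K ^ 10) (hcτeq : X τ 2 = ε ^ 2 / K ^ 10)
    {t : ℝ} (ht : t ∈ Icc (τ + δ + 1 / sqrt K) 2) : X t 0 ^ 2 + X t 3 ^ 2 ≤ 142 / K ^ 20 := by
  have hK0 : 0 < K := by linarith
  have hK1 : 1 ≤ K := by linarith
  obtain ⟨hs0, hs4, hKs, h4, hKs2⟩ := invSqrt_facts hK
  have hτ2 : τ ≤ 2 := by linarith
  have htI : t ∈ Icc (τ + δ) 2 := ⟨by rw [one_div] at ht; linarith [ht.1], ht.2⟩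
  have hEs := Es_decay hX h0 hε hε1 hM0 hMK hK hεK hε100 hεexp hδ hon hτ1 hfit hcτ hcτeq ht
  have hVt := (abs_le.1 (KVe_small hX h0 hε hε1 hM0 hMK hK hεK hεexp hδ hon hτ1 hτ2 hcτ hcτeq htI)).2
  have hsum := traj_sum_sq_eq_one hX h0 t
  have h99 : 1 / 2 / K ^ 99 ≤ 1 / 2 / K ^ 20 := by
    apply div_le_div_of_nonneg_left (by norm_num) (by positivity)
    exact pow_le_pow_right₀ hK1 (by norm_num)
  have h90 : 70 / K ^ 90 ≤ 70 / K ^ 20 := by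
    apply div_le_div_of_nonneg_left (by norm_num) (by positivity)
    exact pow_le_pow_right₀ hK1 (by norm_num)
  have hexp20 : exp ((1 - sqrt K) / 10) ≤ 1 / 2 / K ^ 20 := by
    have h := hN4
    rw [div_div, le_div_iff₀ (by positivity)]
    rw [le_div_iff₀ (by positivity)] at h
    linarith
  -- express everything in the single atom `w = (K²⁰)⁻¹`
  have hw1 : (1 : ℝ) / 2 / K ^ 20 = 1 / 2 * (K ^ 20)⁻¹ := by ring
  have hw2 : (70 : ℝ) / K ^ 20 = 70 * (K ^ 20)⁻¹ := by ring
  have hw3 : (142 : ℝ) / K ^ 20 = 142 * (K ^ 20)⁻¹ := by ring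
  rw [hw3]
  rw [hw1] at hexp20 h99
  rw [hw2] at h90
  have hee : X t 4 * X t 4 = X t 4 ^ 2 := by ring
  linarith [sq_nonneg (X t 1), sq_nonneg (X t 2)]

/-- **(beable), squared form**: for `t ≥ t_c + 1/√K`, `a² + b² + c² + d² ≤ 143K⁻²⁰` (on `[·,2]` from
`ad_small_late` and `b, c = O(ε)`; for `t ≥ 2` by monotonicity of `ã` and (energy-con)).
[cite: Tao2016AveragedNS, §5.5 (beable)] -/
theorem late_sum_sq (hX : ∀ t, HasDerivAt X (delayCircuitWith K M ε (X t)) t) (h0 : IsKickedWith K M ε κ X)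
    (hε : 0 < ε) (hε1 : ε ≤ 1) (hM0 : 0 < M) (hMK : M ≤ K ^ 10) (hK : 16 ≤ K) (hεK : ε ^ 2 ≤ 1 / (6 * K ^ 20))
    (hε100 : ε ≤ 1 / K ^ 100)
    (hεexp : ε ^ 2 ≤ exp (-(18 * M)) / (144 * M * K ^ 20)) (hδ : 0 ≤ δ) (hon : K ^ 110 ≤ exp (M * δ / 8))
    (hN4 : 2 * exp ((1 - sqrt K) / 10) ≤ 1 / K ^ 20)
    (hτ1 : 1 ≤ τ) (hfit : τ + δ + (sqrt K)⁻¹ ≤ 2)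
    (hcτ : ∀ t, 0 ≤ t → t ≤ τ → X t 2 ≤ ε ^ 2 / K ^ 10) (hcτeq : X τ 2 = ε ^ 2 / K ^ 10)
    {t : ℝ} (ht : τ + δ + 1 / sqrt K ≤ t) :
    X t 0 ^ 2 + X t 1 ^ 2 + X t 2 ^ 2 + X t 3 ^ 2 ≤ 143 / K ^ 20 := by
  have hK0 : 0 < K := by linarith
  have hK1 : 1 ≤ K := by linarith
  obtain ⟨hs0, hs4, hKs, h4, hKs2⟩ := invSqrt_facts hK
  -- `b² + c² ≤ K⁻²⁰` on `[0,2]`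
  have hbc : ∀ s ∈ Icc (0 : ℝ) 2, X s 1 ^ 2 + X s 2 ^ 2 ≤ 1 / K ^ 20 := by
    intro s hs
    obtain ⟨hb5, hc5⟩ := bc_small hX h0 hε hε1 hM0.le hs
    have hb2 : X s 1 ^ 2 ≤ (5 * ε) ^ 2 := by
      rw [← sq_abs]; exact pow_le_pow_left₀ (abs_nonneg _) hb5 2
    have hc2 : X s 2 ^ 2 ≤ (5 * ε) ^ 2 := by
      rw [← sq_abs]; exact pow_le_pow_left₀ (abs_nonneg _) hc5 2
    have hεε : ε ^ 2 ≤ ε := by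
      calc ε ^ 2 = ε * ε := sq ε
        _ ≤ ε * 1 := mul_le_mul_of_nonneg_left hε1 hε.le
        _ = ε := mul_one ε
    have h50 : 50 * (1 / K ^ 100) ≤ 1 / K ^ 20 := by
      rw [mul_one_div, div_le_div_iff₀ (by positivity) (by positivity), one_mul]
      have h80 : (50 : ℝ) ≤ K ^ 80 := by
        have : (16 : ℝ) ^ 80 ≤ K ^ 80 := pow_le_pow_left₀ (by norm_num) hK 80
        linarith
      calc (50 : ℝ) * K ^ 20 ≤ K ^ 80 * K ^ 20 := mul_le_mul_of_nonneg_right h80 (by positivity)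
        _ = K ^ 100 := by ring
    have : (5 * ε) ^ 2 = 25 * ε ^ 2 := by ring
    linarith [hεε.trans hε100]
  have hle2 : ∀ s, τ + δ + 1 / sqrt K ≤ s → s ≤ 2 →
      X s 0 ^ 2 + X s 1 ^ 2 + X s 2 ^ 2 + X s 3 ^ 2 ≤ 143 / K ^ 20 := by
    intro s hs1 hs2
    have had := ad_small_late hX h0 hε hε1 hM0 hMK hK hεK hε100 hεexp hδ hon hN4 hτ1 hfit hcτ hcτeq
      ⟨hs1, hs2⟩
    have hs0 : 0 ≤ s := by rw [one_div] at hs1; linarith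
    have := hbc s ⟨hs0, hs2⟩
    have : 142 / K ^ 20 + 1 / K ^ 20 = 143 / K ^ 20 := by ring
    linarith
  by_cases h2 : t ≤ 2
  · exact hle2 t ht h2
  · -- `t > 2`: monotonicity of `ã` from time `2`
    have h2' : 2 < t := not_le.1 h2
    have hτs : τ + δ + 1 / sqrt K ≤ 2 := by rw [one_div]; linarith
    have hS2 := hle2 2 hτs le_rfl
    have hsum2 := traj_sum_sq_eq_one hX h0 2
    have hsumt := traj_sum_sq_eq_one hX h0 t
    have hmonoE := delayCircuitWith_output_monotone hK0.le hX
    have he2t : X 2 4 ≤ X t 4 := hmonoE h2'.le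
    have he20 : 0 ≤ X 2 4 := e_nonneg hX h0 hK0.le (by norm_num)
    have hsq : X 2 4 ^ 2 ≤ X t 4 ^ 2 := pow_le_pow_left₀ he20 he2t 2
    linarith

/-- From `∑_{i≠4} Xᵢ² ≤ 143K⁻²⁰` and (energy-con): all of (beable) with constant `200`.
[cite: Tao2016AveragedNS, §5.5 (beable)] -/
theorem beable_of_sum_sq (hX : ∀ t, HasDerivAt X (delayCircuitWith K M ε (X t)) t)
    (h0 : IsKickedWith K M ε κ X) (hK : 16 ≤ K) {t : ℝ} (ht0 : 0 ≤ t)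
    (hS : X t 0 ^ 2 + X t 1 ^ 2 + X t 2 ^ 2 + X t 3 ^ 2 ≤ 143 / K ^ 20) :
    |X t 4 - 1| ≤ 200 / K ^ 10 ∧ ∀ i : Fin 5, i ≠ 4 → |X t i| ≤ 200 / K ^ 10 := by
  have hK0 : 0 < K := by linarith
  have hK1 : 1 ≤ K := by linarith
  have hsum := traj_sum_sq_eq_one hX h0 t
  have he0 : 0 ≤ X t 4 := e_nonneg hX h0 hK0.le ht0
  have he1 : X t 4 ≤ 1 := (le_abs_self _).trans (traj_abs_le_one hX h0 t 4)
  have h2010 : 143 / K ^ 20 ≤ 143 / K ^ 10 := by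
    apply div_le_div_of_nonneg_left (by norm_num) (by positivity)
    exact pow_le_pow_right₀ hK1 (by norm_num)
  have h143 : 143 / K ^ 10 ≤ 200 / K ^ 10 :=
    div_le_div_of_nonneg_right (by norm_num) (by positivity)
  have hsq : ∀ x : ℝ, x ^ 2 ≤ 143 / K ^ 20 → |x| ≤ 200 / K ^ 10 := by
    intro x hx
    have hx' : x ^ 2 ≤ (12 / K ^ 10) ^ 2 := by
      rw [div_pow, show (K ^ 10) ^ 2 = K ^ 20 by ring]
      exact hx.trans (div_le_div_of_nonneg_right (by norm_num) (by positivity))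
    calc |x| ≤ sqrt ((12 / K ^ 10) ^ 2) := abs_le_sqrt hx'
      _ = 12 / K ^ 10 := sqrt_sq (by positivity)
      _ ≤ 200 / K ^ 10 := div_le_div_of_nonneg_right (by norm_num) (by positivity)
  have hx0 : X t 0 ^ 2 ≤ 143 / K ^ 20 := by
    nlinarith [sq_nonneg (X t 1), sq_nonneg (X t 2), sq_nonneg (X t 3)]
  have hx1 : X t 1 ^ 2 ≤ 143 / K ^ 20 := by
    nlinarith [sq_nonneg (X t 0), sq_nonneg (X t 2), sq_nonneg (X t 3)]
  have hx2 : X t 2 ^ 2 ≤ 143 / K ^ 20 := by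
    nlinarith [sq_nonneg (X t 0), sq_nonneg (X t 1), sq_nonneg (X t 3)]
  have hx3 : X t 3 ^ 2 ≤ 143 / K ^ 20 := by
    nlinarith [sq_nonneg (X t 0), sq_nonneg (X t 1), sq_nonneg (X t 2)]
  have ha := hsq _ hx0
  have hb := hsq _ hx1
  have hc := hsq _ hx2
  have hd := hsq _ hx3
  refine ⟨?_, ?_⟩
  · rw [abs_sub_comm, abs_of_nonneg (by linarith)]
    have : 1 - X t 4 ≤ 1 - X t 4 ^ 2 := by nlinarith
    linarith
  · intro i hi
    fin_cases i
    · exact ha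
    · exact hb
    · exact hc
    · exact hd
    · exact absurd rfl hi

/-- (able2) with constant `200`: on `[0, t_c]`. [cite: Tao2016AveragedNS, §5.5 (able2)] -/
theorem able_window (hX : ∀ t, HasDerivAt X (delayCircuitWith K M ε (X t)) t) (h0 : IsKickedWith K M ε κ X)
    (hε : 0 < ε) (hε1 : ε ≤ 1) (hM0 : 0 ≤ M) (hK : 16 ≤ K) (hεK : ε ^ 2 ≤ 1 / (6 * K ^ 20))
    (hε100 : ε ≤ 1 / K ^ 100) (hτ2 : τ ≤ 2)
    (hcτ : ∀ t, 0 ≤ t → t ≤ τ → X t 2 ≤ ε ^ 2 / K ^ 10)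
    {t : ℝ} (ht : t ∈ Icc 0 τ) :
    |X t 0 - 1| ≤ 200 / K ^ 10 ∧ ∀ i : Fin 5, i ≠ 0 → |X t i| ≤ 200 / K ^ 10 := by
  have hK0 : 0 < K := by linarith
  have hK1 : 1 ≤ K := by linarith
  have ht2 : t ∈ Icc (0 : ℝ) 2 := ⟨ht.1, ht.2.trans hτ2⟩
  have ha := a_near_one hX h0 hε hε1 hM0 hK1 hτ2 hεK hcτ ht
  obtain ⟨hb, hc⟩ := bc_small hX h0 hε hε1 hM0 ht2
  obtain ⟨hd, he⟩ := de_small hX h0 hε hK0 hτ2 hcτ ht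
  have h20 : 8 / K ^ 20 ≤ 200 / K ^ 10 := by
    calc 8 / K ^ 20 ≤ 8 / K ^ 10 := by
          apply div_le_div_of_nonneg_left (by norm_num) (by positivity)
          exact pow_le_pow_right₀ hK1 (by norm_num)
      _ ≤ 200 / K ^ 10 := div_le_div_of_nonneg_right (by norm_num) (by positivity)
  have h5 : 5 * ε ≤ 200 / K ^ 10 := by
    have h1 : 1 / K ^ 100 ≤ 1 / K ^ 10 := by
      apply div_le_div_of_nonneg_left (by norm_num) (by positivity)
      exact pow_le_pow_right₀ hK1 (by norm_num)
    have h2 : 5 * (1 / K ^ 10) ≤ 200 / K ^ 10 := by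
      rw [mul_one_div]; exact div_le_div_of_nonneg_right (by norm_num) (by positivity)
    linarith
  have h3 : 3 / K ^ 10 ≤ 200 / K ^ 10 := div_le_div_of_nonneg_right (by norm_num) (by positivity)
  have hb' := hb.trans h5
  have hc' := hc.trans h5
  have hd' := hd.trans h3
  have he' := he.trans h3
  refine ⟨ha.trans h20, ?_⟩
  intro i hi
  fin_cases i
  · exact absurd rfl hi
  · exact hb'
  · exact hc'
  · exact hd'
  · exact he'

end Decay

section Assembly

/-! ## Assembly of Theorem 5.3 for the family -/

/-- Numerical facts about `ε ≤ ε₁ := exp(-10M)/K¹⁰⁰` for `K ≥ 16`, `0 < M ≤ K¹⁰` (kicked version: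
the last bound carries the extra `K²⁰` the tolerance costs after `t_c`).
[cite: Tao2016AveragedNS, Theorem 5.3 ("if `ε` is sufficiently small depending on `K`")] -/
theorem eps_facts {K M ε : ℝ} (hK : 16 ≤ K) (hM0 : 0 < M) (hMK : M ≤ K ^ 10) (hε : 0 < ε)
    (hεle : ε ≤ exp (-(10 * M)) / K ^ 100) :
    ε ≤ 1 ∧ ε ^ 2 ≤ 1 / (6 * K ^ 20) ∧ ε ≤ 1 / K ^ 100 ∧
      ε ^ 2 ≤ exp (-(18 * M)) / (144 * M * K ^ 20) := by
  have hK0 : 0 < K := by linarith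
  have hK1 : 1 ≤ K := by linarith
  have hexp1 : exp (-(10 * M)) ≤ 1 := by
    rw [exp_le_one_iff, neg_nonpos]; positivity
  have h100 : ε ≤ 1 / K ^ 100 :=
    hεle.trans (div_le_div_of_nonneg_right hexp1 (by positivity))
  have hK100 : (1 : ℝ) ≤ K ^ 100 := one_le_pow₀ hK1
  have h1 : ε ≤ 1 := h100.trans (by rw [div_le_iff₀ (by positivity)]; linarith)
  have hsq : ε ^ 2 ≤ (exp (-(10 * M)) / K ^ 100) ^ 2 := pow_le_pow_left₀ hε.le hεle 2
  refine ⟨h1, ?_, h100, ?_⟩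
  · have h2 : ε ^ 2 ≤ (1 / K ^ 100) ^ 2 := pow_le_pow_left₀ hε.le h100 2
    refine h2.trans ?_
    rw [div_pow, one_pow, div_le_div_iff₀ (by positivity) (by positivity), one_mul, one_mul]
    calc 6 * K ^ 20 ≤ K ^ 180 * K ^ 20 := by
          have : (6 : ℝ) ≤ K ^ 180 := by
            have : (16 : ℝ) ^ 180 ≤ K ^ 180 := pow_le_pow_left₀ (by norm_num) hK 180
            linarith
          exact mul_le_mul_of_nonneg_right this (by positivity)
      _ = (K ^ 100) ^ 2 := by ring
  · refine hsq.trans ?_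
    rw [div_pow, div_le_div_iff₀ (by positivity) (by positivity)]
    have he : exp (-(10 * M)) ^ 2 ≤ exp (-(18 * M)) := by
      rw [← exp_nat_mul, exp_le_exp]; push_cast; nlinarith
    have hp : 144 * M * K ^ 20 ≤ (K ^ 100) ^ 2 := by
      have hK20 : (0 : ℝ) ≤ K ^ 20 := by positivity
      calc 144 * M * K ^ 20 ≤ 144 * K ^ 10 * K ^ 20 :=
            mul_le_mul_of_nonneg_right (by linarith) hK20
        _ ≤ K ^ 170 * K ^ 10 * K ^ 20 := by
            have : (144 : ℝ) ≤ K ^ 170 := by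
              have : (16 : ℝ) ^ 170 ≤ K ^ 170 := pow_le_pow_left₀ (by norm_num) hK 170
              linarith
            exact mul_le_mul_of_nonneg_right (mul_le_mul_of_nonneg_right this (by positivity))
              hK20
        _ = (K ^ 100) ^ 2 := by ring
    exact mul_le_mul he hp (by positivity) (exp_pos _).le

/-- **Parameter bookkeeping for the family (kicked version: `88 log K ≤ M`).** For
`K ≥ K₀ = 2·20⁴²·42! + 16` and `3000 log K ≤ M ≤ K¹⁰`: `K ≥ 16`, `M > 0`, `88 log K ≤ M`, the
numeric input (N4)
`2e^{(1-√K)/10} ≤ K⁻²⁰`, and for the onset delay `δ = 880 log K / M`: `δ ≥ 0`,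
`e^{Mδ/8} = K¹¹⁰` (so (c-large) applies from `t_c + δ` on), `δ ≤ 880/3000`, `2/M ≤ 1/3000`.
[cite: Tao2016AveragedNS, §5.5 ("if `K` is sufficiently large")] -/
theorem family_params {K M : ℝ} (hK : 2 * 20 ^ 42 * (Nat.factorial 42 : ℝ) + 16 ≤ K)
    (hML : 3000 * Real.log K ≤ M) :
    16 ≤ K ∧ 0 < M ∧ 88 * Real.log K ≤ M ∧ 2 ≤ Real.log K ∧
    2 * exp ((1 - sqrt K) / 10) ≤ 1 / K ^ 20 ∧
    0 ≤ 880 * Real.log K / M ∧ K ^ 110 ≤ exp (M * (880 * Real.log K / M) / 8) ∧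
    880 * Real.log K / M ≤ 880 / 3000 ∧ 2 / M ≤ 1 / 3000 := by
  have hB : (0 : ℝ) ≤ 2 * 20 ^ 42 * (Nat.factorial 42 : ℝ) := by positivity
  have hK16 : 16 ≤ K := by linarith
  have hK0 : 0 < K := by linarith
  have hlog2 : 2 ≤ Real.log K := (log_facts hK16).1
  have hM0 : 0 < M := by nlinarith
  have hN4 : 2 * exp ((1 - sqrt K) / 10) ≤ 1 / K ^ 20 := numeric_N4 hK16 (by linarith)
  have hδ0 : 0 ≤ 880 * Real.log K / M := div_nonneg (by nlinarith) hM0.le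
  have hexp : M * (880 * Real.log K / M) / 8 = (110 : ℕ) * Real.log K := by
    push_cast; field_simp; ring
  have hon : K ^ 110 ≤ exp (M * (880 * Real.log K / M) / 8) := by
    rw [hexp, Real.exp_nat_mul, Real.exp_log hK0]
  have hLM : Real.log K / M ≤ 1 / 3000 := by
    rw [div_le_div_iff₀ hM0 (by norm_num)]; linarith
  have hδle : 880 * Real.log K / M ≤ 880 / 3000 := by
    rw [mul_div_assoc]; linarith
  have h2M : 2 / M ≤ 1 / 3000 := by
    rw [div_le_div_iff₀ hM0 (by norm_num)]; nlinarith
  exact ⟨hK16, hM0, by linarith, hlog2, hN4, hδ0, hon, hδle, h2M⟩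

end Assembly
end Thm53KickWith

/-! ## Theorem 5.3 for the family from the kicked datum -/

/-- **Theorem 5.3 for the family from a kicked datum, explicit constants (all `M` at once).**
For `K ≥ 2·20⁴²·42! + 16`, `3000 log K ≤ M ≤ K¹⁰`, `0 < ε ≤ e^{-10M}/K¹⁰⁰` and ANY pre-load
`0 ≤ κ ≤ kickToleranceWith K M ε = ε²e^{-M}K¹⁰` of the trigger mode: every global trajectory of
`delayCircuitWith K M ε` from `kickInit κ` is quiet (`a = 1 + O(K⁻¹⁰)`, rest `O(K⁻¹⁰)`, constant
`200`) on `[0, t_c]` with `|t_c - √2| ≤ 44 log K / M`, and has fired for all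
`t ≥ t_c + 880 log K / M + 1/√K`. Compared with `transitionWith_explicit` (designed datum) only
the window constant changes (`24 ↦ 44`); `κ = 0` is allowed (`kickInit 0 = delayInit`,
`kickInit_zero`). [cite: Tao2016AveragedNS, Theorem 5.3, §5.5] -/
theorem kickTransitionWith_explicit {K M ε κ : ℝ} {X : ℝ → Fin 5 → ℝ}
    (hK : 2 * 20 ^ 42 * (Nat.factorial 42 : ℝ) + 16 ≤ K) (hML : 3000 * Real.log K ≤ M)
    (hMK : M ≤ K ^ 10) (hε : 0 < ε) (hεle : ε ≤ exp (-(10 * M)) / K ^ 100)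
    (hκ0 : 0 ≤ κ) (hκ : κ ≤ kickToleranceWith K M ε) (h0 : X 0 = kickInit κ)
    (hX : ∀ t, HasDerivAt X (delayCircuitWith K M ε (X t)) t) :
    ∃ tc : ℝ, |tc - Real.sqrt 2| ≤ 44 * Real.log K / M ∧
      (∀ t ∈ Set.Icc 0 tc,
        |X t 0 - 1| ≤ 200 / K ^ 10 ∧ ∀ i : Fin 5, i ≠ 0 → |X t i| ≤ 200 / K ^ 10) ∧
      (∀ t, tc + 880 * Real.log K / M + 1 / Real.sqrt K ≤ t →
        |X t 4 - 1| ≤ 200 / K ^ 10 ∧ ∀ i : Fin 5, i ≠ 4 → |X t i| ≤ 200 / K ^ 10) := by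
  obtain ⟨hK16, hM0, hML88, hlog2, hN4, hδ, hon, hδle, h2M⟩ :=
    Thm53KickWith.family_params hK hML
  have hK0 : 0 < K := by linarith
  obtain ⟨hε1, hεK, hε100, hεexp⟩ := Thm53KickWith.eps_facts hK16 hM0 hMK hε hεle
  have hk : Thm53KickWith.IsKickedWith K M ε κ X :=
    Thm53KickWith.IsKickedWith.of_le_tolerance (by linarith) (by linarith) hε hε1 hκ0 hκ h0
  -- the critical time: first hitting time of the level `K⁻¹⁰ε²` by `c` on `[0,2]`
  -- (the kick starts strictly below it: `IsKickedWith.lt_level`)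
  obtain ⟨τ, hτ0, hτ2, hcτ, hτeq⟩ := Thm53.exists_hitTime (Thm53With.continuous_traj hX 2)
    (θ := ε ^ 2 / K ^ 10) (T := 2) two_pos
    (by rw [Thm53KickWith.init_c hk]; exact hk.lt_level (by linarith) (by linarith) hε)
  obtain ⟨hlo, hhi, hτ1, hτ32, hcτeq⟩ :=
    Thm53KickWith.tc_window hX hk hε hε1 hM0 hMK hK16 hML88 hεK hτ0 hτ2 hcτ hτeq
  have hfit : τ + 880 * Real.log K / M + (sqrt K)⁻¹ ≤ 2 :=
    Thm53With.window_fits hK16 hτ1 hhi h2M hδle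
  refine ⟨τ, Thm53With.abs_sub_sqrt_two_le hτ1 (div_nonneg (by linarith) hM0.le)
      (div_le_div_of_nonneg_right (by linarith) hM0.le) hlo hhi, ?_, ?_⟩
  · -- (able), on all of `[0, t_c]`
    intro t ht
    exact Thm53KickWith.able_window hX hk hε hε1 hM0.le hK16 hεK hε100 hτ2 hcτ ht
  · -- (beable)
    intro t ht
    have ht0 : 0 ≤ t := by
      have : 0 < (sqrt K)⁻¹ := (Thm53.invSqrt_facts hK16).1
      rw [one_div] at ht; linarith
    exact Thm53KickWith.beable_of_sum_sq hX hk hK16 ht0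
      (Thm53KickWith.late_sum_sq hX hk hε hε1 hM0 hMK hK16 hεK hε100 hεexp hδ hon hN4 hτ1 hfit
        hcτ hcτeq ht)

/-- **Polynomial trigger tolerance (the member `M = p log K`).** For `p ≥ 3000`,
`K ≥ 2·20⁴²·42! + 16` with `p ≤ K⁹`, `0 < ε ≤ K^{-(10p+100)}` and ANY pre-load
`0 ≤ κ ≤ ε²K¹⁰/Kᵖ` of the trigger mode: the circuit with seed `ε²K⁻ᵖ` and amplifier `ε⁻¹p log K`
from `kickInit κ` is quiet on `[0, t_c]` with `|t_c - √2| ≤ 44/p` and has fired for all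
`t ≥ t_c + 880/p + 1/√K`. Seed, `ε`-threshold AND trigger tolerance are powers of `K`
(for Tao's `M = K¹⁰` the tolerance is `ε²e^{-K¹⁰(1-o(1))}`, `TriggerTolerance.lean`).
[cite: Tao2016AveragedNS, Theorem 5.3, §5.5] -/
theorem polySeedKickTolerance {K ε κ : ℝ} {p : ℕ} {X : ℝ → Fin 5 → ℝ}
    (hK : 2 * 20 ^ 42 * (Nat.factorial 42 : ℝ) + 16 ≤ K) (hp : (3000 : ℝ) ≤ p)
    (hpK : (p : ℝ) ≤ K ^ 9) (hε : 0 < ε) (hεle : ε ≤ 1 / K ^ (10 * p + 100))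
    (hκ0 : 0 ≤ κ) (hκ : κ ≤ ε ^ 2 * K ^ 10 / K ^ p) (h0 : X 0 = kickInit κ)
    (hX : ∀ t, HasDerivAt X (delayCircuitWith K (p * Real.log K) ε (X t)) t) :
    ∃ tc : ℝ, |tc - Real.sqrt 2| ≤ 44 / p ∧
      (∀ t ∈ Set.Icc 0 tc,
        |X t 0 - 1| ≤ 200 / K ^ 10 ∧ ∀ i : Fin 5, i ≠ 0 → |X t i| ≤ 200 / K ^ 10) ∧
      (∀ t, tc + 880 / p + 1 / Real.sqrt K ≤ t →
        |X t 4 - 1| ≤ 200 / K ^ 10 ∧ ∀ i : Fin 5, i ≠ 4 → |X t i| ≤ 200 / K ^ 10) := by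
  have hB : (0 : ℝ) ≤ 2 * 20 ^ 42 * (Nat.factorial 42 : ℝ) := by positivity
  have hK16 : 16 ≤ K := by linarith
  have hK0 : 0 < K := by linarith
  obtain ⟨hlog2, -, hlog0⟩ := Thm53With.log_facts hK16
  have hp0 : (0 : ℝ) < p := by linarith
  have hlogK : Real.log K ≤ K := (Real.log_le_sub_one_of_pos hK0).trans (by linarith)
  -- admissibility of `M = p log K`
  have hML : 3000 * Real.log K ≤ p * Real.log K := mul_le_mul_of_nonneg_right hp hlog0.le
  have hMK : p * Real.log K ≤ K ^ 10 := by
    calc (p : ℝ) * Real.log K ≤ K ^ 9 * K := mul_le_mul hpK hlogK hlog0.le (by positivity)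
      _ = K ^ 10 := by ring
  -- the ε-threshold is a power of K: `e^{-10 p log K}/K¹⁰⁰ = K^{-(10p+100)}`
  have hεeq : exp (-(10 * (p * Real.log K))) / K ^ 100 = 1 / K ^ (10 * p + 100) := by
    have : (10 : ℝ) * (p * Real.log K) = ((10 * p : ℕ) : ℝ) * Real.log K := by push_cast; ring
    rw [this, exp_neg_natMul_log hK0, pow_add]
    field_simp
  have hεle' : ε ≤ exp (-(10 * (p * Real.log K))) / K ^ 100 := by rw [hεeq]; exact hεle
  -- the tolerance is a power of K
  have hκ' : κ ≤ kickToleranceWith K (p * Real.log K) ε := by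
    rw [kickToleranceWith_log hK0]; exact hκ
  obtain ⟨tc, htc, hearly, hlate⟩ := kickTransitionWith_explicit hK hML hMK hε hεle' hκ0 hκ' h0 hX
  have h44 : 44 * Real.log K / (p * Real.log K) = 44 / p := by
    field_simp
  have h880 : 880 * Real.log K / (p * Real.log K) = 880 / p := by
    field_simp
  refine ⟨tc, by rw [← h44]; exact htc, hearly, fun t ht => hlate t (by rw [h880]; exact ht)⟩

/-- **The designed datum is the case `κ = 0`**: `kickTransitionWith_explicit` contains Theorem 5.3
for the family from `delayInit` (with window constant `44`). [cite: Tao2016AveragedNS, Theorem 5.3] -/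
theorem kickTransitionWith_designed {K M ε : ℝ} {X : ℝ → Fin 5 → ℝ}
    (hK : 2 * 20 ^ 42 * (Nat.factorial 42 : ℝ) + 16 ≤ K) (hML : 3000 * Real.log K ≤ M)
    (hMK : M ≤ K ^ 10) (hε : 0 < ε) (hεle : ε ≤ exp (-(10 * M)) / K ^ 100)
    (h0 : X 0 = delayInit) (hX : ∀ t, HasDerivAt X (delayCircuitWith K M ε (X t)) t) :
    ∃ tc : ℝ, |tc - Real.sqrt 2| ≤ 44 * Real.log K / M ∧
      (∀ t ∈ Set.Icc 0 tc,
        |X t 0 - 1| ≤ 200 / K ^ 10 ∧ ∀ i : Fin 5, i ≠ 0 → |X t i| ≤ 200 / K ^ 10) ∧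
      (∀ t, tc + 880 * Real.log K / M + 1 / Real.sqrt K ≤ t →
        |X t 4 - 1| ≤ 200 / K ^ 10 ∧ ∀ i : Fin 5, i ≠ 4 → |X t i| ≤ 200 / K ^ 10) := by
  have hB : (0 : ℝ) ≤ 2 * 20 ^ 42 * (Nat.factorial 42 : ℝ) := by positivity
  have hK0 : 0 < K := by linarith
  exact kickTransitionWith_explicit hK hML hMK hε hεle le_rfl
    (kickToleranceWith_pos hK0 hε).le (by rw [h0, kickInit_zero]) hX

end Literature.Analysis.FluidPDE.Tao2016AveragedNS
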